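import Literature.NumberTheory.Automorphic.ArchHeckeTestVectorConstructionGL2
import Literature.NumberTheory.Automorphic.ArchWeightIntegrality
import Literature.NumberTheory.Automorphic.ArchMaximalCompactGeneratorsGL2
import Literature.NumberTheory.Automorphic.HeckeEulerFactorisationGL2DualKirillov
import Literature.NumberTheory.Automorphic.MixedSpaceUnitsIntegration
import HarnessLib

/-!
# The dual archimedean Hecke test vector `τ(w) e₀` for `GL₂(K_∞)`
# (Jacquet–Langlands (1970), §5 Thm. 5.15, §6 Thm. 6.4, proof of Thm. 11.1)

Topic `NumberTheory/Automorphic`; namespace `Literature.NumberTheory.Automorphic`. Definitions with bodies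
(the dual tagged types and their shape functions) and theorems; no named fact, no instance.

For the test vector `e₀` of `ArchHeckeTestVectorConstructionGL2` (tagged final types at all places) we analyse
`τ(w_L) e₀`, `w_L = (0 1; 1 0)`: place by place, `w_L = ∏_w g_w` with `g_w = exp((π/2)W_w) δ_w` at a real place
and `g_w = exp((π/2)J_w) exp(π E₀₀ ⊗ ic_w)` at a complex place, and each `τ(g_w)` maps a vector of a final type at
`w` to a NON-ZERO multiple of a vector of the DUAL type at `w` (upper discrete ↦ lower discrete, even weight-one
symmetrisation ↦ odd one with `κ ↦ -κ`, holomorphic powers ↦ antiholomorphic powers of the lowest vector and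
conversely, `F^j y ↦ F^{m-j} y`), by the weight calculus (`exp((π/2)W)` acts on a weight-`k` vector by `e^{ikπ/2}`),
the `Ad`-identities `Ad(g)(X⁺+X⁻) = -(X⁺+X⁻)`, `Ad(g)E^{h,a}_{01} = -E^{h,a}_{10}`, and the Weyl datum of the
complex inner vector. Hence `τ(w_L) e₀ = c z` with `c ≠ 0` and `z` dual-tagged at all places, and the central
character `ω` of `τ` twists the Kirillov function of `z` into rigid shapes whose Mellin transforms are again
Gamma products.

## References

* H. Jacquet, R. P. Langlands, *Automorphic Forms on GL(2)*, LNM 114 (1970), §5 (Thm. 5.13, 5.15), §6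
  (Thm. 6.2–6.4), §11 (proof of Thm. 11.1). [JacquetLanglands1970]
* A. W. Knapp, *Representation Theory of Semisimple Groups* (1986), Ch. VIII §3. [Knapp1986]
-/

noncomputable section

open MeasureTheory Measure NumberField NumberField.InfinitePlace NumberField.mixedEmbedding IsDedekindDomain Set Filter
open scoped MatrixGroups Topology Classical InnerProductSpace

namespace Literature.NumberTheory.Automorphic

variable {K : Type} [Field K] [NumberField K]

-- as in `ArchGardingWhittaker`
set_option backward.isDefEq.respectTransparency false

/-! ### 1. The Weyl element at a real place -/

section RealPlace

variable {hcpt : isCompact_glFiniteIntegralLevel 2 K}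
  {E : Type*} [NormedAddCommGroup E] [InnerProductSpace ℂ E] [CompleteSpace E]
  {τ : ContRepresentation ℂ (AutomorphyDatum.gl 2 K hcpt).arch.carrier E}
  (hτ : τ.IsStronglyContinuous) (w : {w : InfinitePlace K // IsReal w})

local notation "H₀" => Matrix.single (0 : Fin 2) (0 : Fin 2) ((Pi.single w 1, 0) : mixedSpace K)
local notation "H₁" => Matrix.single (1 : Fin 2) (1 : Fin 2) ((Pi.single w 1, 0) : mixedSpace K)
local notation "X⁺" => Matrix.single (0 : Fin 2) (1 : Fin 2) ((Pi.single w 1, 0) : mixedSpace K)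
local notation "X⁻" => Matrix.single (1 : Fin 2) (0 : Fin 2) ((Pi.single w 1, 0) : mixedSpace K)
local notation "D" => gardingEnd (hcpt := hcpt) (τ := τ) hτ
local notation "Lo" => (gardingEnd (hcpt := hcpt) (τ := τ) hτ (H₀ - H₁) - Complex.I • gardingEnd (hcpt := hcpt) (τ := τ) hτ (X⁺ + X⁻))
local notation "Ra" => (gardingEnd (hcpt := hcpt) (τ := τ) hτ (H₀ - H₁) + Complex.I • gardingEnd (hcpt := hcpt) (τ := τ) hτ (X⁺ + X⁻))
local notation "Rr" => gardingAct (hcpt := hcpt) (τ := τ) hτ (expGL ((Real.pi / 2 : ℝ) • (X⁺ - X⁻)))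

/-- **The dual real types**, indexed by the direct tag. [cite: JacquetLanglands1970, §5 Thm. 5.15] -/
def DualRealTagged (δ : GL (Fin 2) (mixedSpace K)) (μ lam : ℂ) : RealTag → archGardingSpace hcpt τ → Prop
  | .discPlus k, v => 1 ≤ k ∧ RealDiscMinus hτ w v k μ
  | .weightOneSym κ, v => RealWeightOneSym hτ w δ v (-1) (-κ) μ lam
  | .weightZero, v => RealWeightZero hτ w δ v 1 μ lam
  | .weightZeroX, v => RealWeightZeroX hτ w δ v 1 μ lam

variable {hτ w}

/-- Transport of the dual real types. [folklore] -/
theorem DualRealTagged.map {δ : GL (Fin 2) (mixedSpace K)} {μ lam : ℂ} {Φ : Module.End ℂ (archGardingSpace hcpt τ)}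
    (hΦ : ∀ i j : Fin 2, Commute Φ (gardingEnd hτ (Matrix.single i j ((Pi.single w 1, 0) : mixedSpace K))))
    (hΦδ : Commute Φ (gardingAct hτ δ)) : ∀ {t : RealTag} {v : archGardingSpace hcpt τ},
    DualRealTagged hτ w δ μ lam t v → DualRealTagged hτ w δ μ lam t (Φ v)
  | .discPlus _, _, ⟨hk, h⟩ => ⟨hk, h.map w hΦ⟩
  | .weightOneSym _, _, h => RealWeightOneSym.map w hΦ hΦδ h
  | .weightZero, _, h => RealWeightZero.map w hΦ hΦδ h
  | .weightZeroX, _, h => RealWeightZeroX.map w hΦ hΦδ h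

/-- **`exp((π/2) W_w)` acts on a vector of weight `k` by `e^{ikπ/2}`.** [cite: Bump1997, §2.2] -/
theorem apply_weylRotR_of_weight {v : archGardingSpace hcpt τ} {k : ℂ} (hW : D (X⁺ - X⁻) v = (Complex.I * k) • v) :
    Rr v = Complex.exp (Complex.I * k * (Real.pi / 2 : ℝ)) • v := by
  have hE : archDerivE hcpt τ (X⁺ - X⁻) (v : E) = (Complex.I * k) • (v : E) := by
    have h1 := congrArg Subtype.val hW
    rwa [coe_gardingEnd_apply, Submodule.coe_smul] at h1
  refine Subtype.ext ?_
  rw [coe_gardingAct_apply, apply_expGL_smul_eq_exp_smul hτ _ v.2 hE, Submodule.coe_smul]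

omit [NumberField K] in
/-- Matrix facts at a real place: `WS = H₀ - H₁ = -SW`, `PS = S = SP` for `W = X⁺-X⁻`, `S = X⁺+X⁻`, `P = H₀+H₁`.
[folklore] -/
theorem realPlace_matrix_facts :
    (X⁺ - X⁻) * (X⁺ + X⁻) = H₀ - H₁ ∧ (X⁺ + X⁻) * (X⁺ - X⁻) = -(H₀ - H₁) ∧
    (H₀ + H₁) * (X⁺ + X⁻) = X⁺ + X⁻ ∧ (X⁺ + X⁻) * (H₀ + H₁) = X⁺ + X⁻ ∧
    (H₀ - H₁) * (H₀ + H₁) = H₀ - H₁ ∧ (H₀ - H₁) * (X⁺ - X⁻) = X⁺ + X⁻ := by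
  have hrr : ((Pi.single w 1, 0) : mixedSpace K) * ((Pi.single w 1, 0) : mixedSpace K) = ((Pi.single w 1, 0) : mixedSpace K) :=
    realIdem_mul_self (K := K) w
  refine ⟨?_, ?_, ?_, ?_, ?_, ?_⟩ <;>
    simp only [mul_sub, sub_mul, mul_add, add_mul, single_mul_single_eq, hrr] <;> simp <;> abel

/-- The matrix of `exp((π/2) W_w)` is `1 - P_w + W_w`. [folklore] -/
theorem coe_weylRotR :
    ((expGL ((Real.pi / 2 : ℝ) • (X⁺ - X⁻)) : GL (Fin 2) (mixedSpace K)) : Matrix (Fin 2) (Fin 2) (mixedSpace K)) =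
      1 - (H₀ + H₁) + (X⁺ - X⁻) := by
  open scoped Matrix.Norms.Operator in
  rw [coe_expGL, exp_smul_eq_of_sq_eq_neg (weylR_sq (K := K) w).1 (weylR_sq (K := K) w).2, Real.cos_pi_div_two,
    Real.sin_pi_div_two, zero_sub, neg_one_smul, one_smul]
  abel

/-- `exp((π/2)W) (X⁺+X⁻) = -(X⁺+X⁻) exp((π/2)W)`. [folklore] -/
theorem weylRotR_mul_xSum :
    ((expGL ((Real.pi / 2 : ℝ) • (X⁺ - X⁻)) : GL (Fin 2) (mixedSpace K)) : Matrix (Fin 2) (Fin 2) (mixedSpace K)) * (X⁺ + X⁻) =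
      -((X⁺ + X⁻) * ((expGL ((Real.pi / 2 : ℝ) • (X⁺ - X⁻)) : GL (Fin 2) (mixedSpace K)) : Matrix (Fin 2) (Fin 2) (mixedSpace K))) := by
  obtain ⟨hWS, hSW, hPS, hSP, -, -⟩ := realPlace_matrix_facts (K := K) (w := w)
  rw [coe_weylRotR, add_mul, sub_mul, one_mul, hPS, hWS, mul_add, mul_sub, mul_one, hSP, hSW]
  abel

/-- `exp((π/2)W) τ(X⁺+X⁻) v = -τ(X⁺+X⁻) exp((π/2)W) v`. [folklore] -/
theorem weylRotR_xSum_apply (v : archGardingSpace hcpt τ) : Rr (D (X⁺ + X⁻) v) = -(D (X⁺ + X⁻) (Rr v)) := by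
  have hconj : ((expGL ((Real.pi / 2 : ℝ) • (X⁺ - X⁻)) : GL (Fin 2) (mixedSpace K)) : Matrix (Fin 2) (Fin 2) (mixedSpace K)) * (X⁺ + X⁻) *
      (((expGL ((Real.pi / 2 : ℝ) • (X⁺ - X⁻)))⁻¹ : GL (Fin 2) (mixedSpace K)) : Matrix (Fin 2) (Fin 2) (mixedSpace K)) = -(X⁺ + X⁻) := by
    rw [weylRotR_mul_xSum, Matrix.neg_mul, Matrix.mul_assoc, ← Units.val_mul, mul_inv_cancel, Units.val_one, Matrix.mul_one]
  have h := gardingAct_mul_gardingEnd (hcpt := hcpt) (τ := τ) hτ (expGL ((Real.pi / 2 : ℝ) • (X⁺ - X⁻))) (X⁺ + X⁻)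
  rw [hconj, gardingEnd_neg] at h
  have h' := congrArg (fun T => T v) h
  simp only [Module.End.mul_apply, LinearMap.neg_apply] at h'
  exact h'

/-- `e^{iπ/2} = i`. [folklore] -/
theorem exp_I_mul_pi_div_two : Complex.exp (Complex.I * 1 * (Real.pi / 2 : ℝ)) = Complex.I := by
  rw [mul_one, show Complex.I * ((Real.pi / 2 : ℝ) : ℂ) = (Real.pi / 2 : ℂ) * Complex.I by push_cast; ring, Complex.exp_mul_I]
  rw [show (Real.pi / 2 : ℂ) = ((Real.pi / 2 : ℝ) : ℂ) by push_cast; ring, ← Complex.ofReal_cos, ← Complex.ofReal_sin,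
    Real.cos_pi_div_two, Real.sin_pi_div_two]
  simp

/-- `e^{-iπ/2} = -i`. [folklore] -/
theorem exp_neg_I_mul_pi_div_two : Complex.exp (Complex.I * (-1) * (Real.pi / 2 : ℝ)) = -Complex.I := by
  have h : Complex.I * (-1) * ((Real.pi / 2 : ℝ) : ℂ) = -(Complex.I * 1 * ((Real.pi / 2 : ℝ) : ℂ)) := by ring
  rw [h, Complex.exp_neg, exp_I_mul_pi_div_two, Complex.inv_I]

variable {δ : GL (Fin 2) (mixedSpace K)}
  (hδ : (δ : Matrix (Fin 2) (Fin 2) (mixedSpace K)) = 1 - (2 : ℝ) • Matrix.single (0 : Fin 2) (0 : Fin 2) ((Pi.single w 1, 0) : mixedSpace K))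
  (hτu : τ.IsUnitary) {ℓ : archGardingSpace hcpt τ →ₗ[ℂ] ℂ} (hℓW : IsArchContWhittakerFunctional hcpt τ hτ ℓ)
include hδ hτu hℓW

/-- **The Weyl element at a real place maps a tagged vector to a non-zero multiple of a dual-tagged vector.**
[cite: JacquetLanglands1970, §5 Thm. 5.15] -/
theorem exists_dual_of_realTagged {μ lam : ℂ} (ν : ℂ) (hlam : lam = μ ^ 2 / 2 - 2 * ν ^ 2 - 1 / 2)
    {t : RealTag} {v : archGardingSpace hcpt τ} (h : RealTagged hτ w δ μ lam t v) :
    ∃ c : ℂ, c ≠ 0 ∧ ∃ v' : archGardingSpace hcpt τ, DualRealTagged hτ w δ μ lam t v' ∧ Rr (gardingAct hτ δ v) = c • v' := by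
  cases t with
  | discPlus k =>
    obtain ⟨hk, h⟩ := h
    have hW' := realSign_weight hτ hδ h.weyl
    refine ⟨Complex.exp (Complex.I * -(k : ℂ) * (Real.pi / 2 : ℝ)), Complex.exp_ne_zero _, gardingAct hτ δ v, ⟨hk, ⟨hW', realSign_central hτ hδ h.centre, ?_⟩⟩,
      apply_weylRotR_of_weight hW'⟩
    have h1 := realSign_lowering hτ hδ (v := v) (by have h2 := h.lowering; rwa [LinearMap.sub_apply, LinearMap.smul_apply] at h2)
    rw [LinearMap.add_apply, LinearMap.smul_apply]
    exact h1
  | weightZero =>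
    refine ⟨1, one_ne_zero, v, h, ?_⟩
    rw [h.sign, one_smul, apply_weylRotR_of_weight (k := 0) (by rw [h.weyl, mul_zero, zero_smul]), mul_zero, zero_mul,
      Complex.exp_zero, one_smul]
  | weightZeroX =>
    obtain ⟨hsign, -⟩ := h.radial w hτu hℓW hδ ν hlam
    obtain ⟨v'', hW'', -, -, -, hv⟩ := h.exists_inner
    refine ⟨-1, by norm_num, v, h, ?_⟩
    rw [hsign, one_smul, hv, weylRotR_xSum_apply, apply_weylRotR_of_weight (k := 0) (by rw [hW'', mul_zero, zero_smul]), mul_zero,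
      zero_mul, Complex.exp_zero, one_smul, neg_one_smul]
  | weightOneSym κ =>
    obtain ⟨hsign, -⟩ := h.radial w hδ hτu hℓW
    obtain ⟨v'', hW'', hZ'', hC'', hv⟩ := h.exists_inner
    -- weights of the four pieces
    have h1 : Rr v'' = Complex.I • v'' := by rw [apply_weylRotR_of_weight (k := 1) (by rw [mul_one]; exact hW''), exp_I_mul_pi_div_two]
    have hWL := rotGen_lowering_apply hτ w 1 v'' (by rw [mul_one]; exact hW'')
    have h2 : Rr (Lo v'') = (-Complex.I) • Lo v'' := by
      rw [apply_weylRotR_of_weight (k := 1 - 2) hWL, show (1 : ℂ) - 2 = -1 by norm_num, exp_neg_I_mul_pi_div_two]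
    have h3 : Rr (gardingAct hτ δ v'') = (-Complex.I) • gardingAct hτ δ v'' := by
      rw [apply_weylRotR_of_weight (realSign_weight hτ hδ (k := 1) (by rw [mul_one]; exact hW'')), exp_neg_I_mul_pi_div_two]
    have h4 : Rr (gardingAct hτ δ (Lo v'')) = Complex.I • gardingAct hτ δ (Lo v'') := by
      have h5 := realSign_weight hτ hδ hWL
      rw [apply_weylRotR_of_weight h5, show -((1 : ℂ) - 2) = 1 by norm_num, exp_I_mul_pi_div_two]
    refine ⟨Complex.I, Complex.I_ne_zero,
      (v'' + (1 / (2 * -κ)) • Lo v'') + (-1 : ℂ) • gardingAct hτ δ (v'' + (1 / (2 * -κ)) • Lo v''),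
      ⟨Or.inr rfl, by rw [mul_neg, neg_sq]; exact h.kappa_sq, neg_ne_zero.mpr h.kappa_ne, v'', hW'', hZ'', hC'', rfl⟩, ?_⟩
    rw [hsign, one_smul, hv, one_smul, map_add, map_add, map_smul, map_add, map_add, map_smul, map_smul, h1, h2, h3, h4]
    have hc : (1 : ℂ) / (2 * -κ) = -(1 / (2 * κ)) := by rw [mul_neg, div_neg]
    rw [hc, map_add, map_smul]
    module

end RealPlace

/-! ### 2. The Weyl element at a complex place -/

section ComplexPlace

variable {hcpt : isCompact_glFiniteIntegralLevel 2 K}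
  {E : Type*} [NormedAddCommGroup E] [InnerProductSpace ℂ E] [CompleteSpace E]
  {τ : ContRepresentation ℂ (AutomorphyDatum.gl 2 K hcpt).arch.carrier E}
  (hτ : τ.IsStronglyContinuous) (w : {w : InfinitePlace K // IsComplex w})

local notation "𝐜" => ((0, Pi.single w 1) : mixedSpace K)
local notation "𝐜I" => ((0, Pi.single w Complex.I) : mixedSpace K)
local notation "D" => gardingEnd (hcpt := hcpt) (τ := τ) hτ
local notation "Dh[" i "," j "]" => (gardingEnd (hcpt := hcpt) (τ := τ) hτ (Matrix.single (i : Fin 2) (j : Fin 2) ((0, Pi.single w 1) : mixedSpace K)) -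
  Complex.I • gardingEnd (hcpt := hcpt) (τ := τ) hτ (Matrix.single (i : Fin 2) (j : Fin 2) ((0, Pi.single w Complex.I) : mixedSpace K)))
local notation "Da[" i "," j "]" => (gardingEnd (hcpt := hcpt) (τ := τ) hτ (Matrix.single (i : Fin 2) (j : Fin 2) ((0, Pi.single w 1) : mixedSpace K)) +
  Complex.I • gardingEnd (hcpt := hcpt) (τ := τ) hτ (Matrix.single (i : Fin 2) (j : Fin 2) ((0, Pi.single w Complex.I) : mixedSpace K)))
local notation "Tc" => (Matrix.single (0 : Fin 2) (0 : Fin 2) ((0, Pi.single w Complex.I) : mixedSpace K) -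
  Matrix.single (1 : Fin 2) (1 : Fin 2) ((0, Pi.single w Complex.I) : mixedSpace K))
local notation "Zc" => (Matrix.single (0 : Fin 2) (0 : Fin 2) ((0, Pi.single w Complex.I) : mixedSpace K) +
  Matrix.single (1 : Fin 2) (1 : Fin 2) ((0, Pi.single w Complex.I) : mixedSpace K))
local notation "Jc" => (Matrix.single (0 : Fin 2) (1 : Fin 2) ((0, Pi.single w 1) : mixedSpace K) -
  Matrix.single (1 : Fin 2) (0 : Fin 2) ((0, Pi.single w 1) : mixedSpace K))
local notation "Rc" => gardingAct (hcpt := hcpt) (τ := τ) hτ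
  (expGL ((Real.pi / 2 : ℝ) • (Matrix.single (0 : Fin 2) (1 : Fin 2) ((0, Pi.single w 1) : mixedSpace K) -
    Matrix.single (1 : Fin 2) (0 : Fin 2) ((0, Pi.single w 1) : mixedSpace K))))
local notation "Pπ" => gardingAct (hcpt := hcpt) (τ := τ) hτ
  (expGL ((Real.pi : ℝ) • Matrix.single (0 : Fin 2) (0 : Fin 2) ((0, Pi.single w Complex.I) : mixedSpace K)))

/-- **The dual complex types**, indexed by the direct tag; the torus condition is now `it = μ₂`.
[cite: JacquetLanglands1970, §6 Thm. 6.4] -/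
def DualComplexTagged (m : ℕ) (μ₂ : ℂ) : ComplexTag → archGardingSpace hcpt τ → Prop
  | .holPow b, v => ComplexAntiPowLowest hτ w v b m ∧ Complex.I * (-(m : ℂ) - 2 * b) = μ₂
  | .antiPowLowest b, v => ComplexHolPow hτ w v b m ∧ Complex.I * ((m : ℂ) + 2 * b) = μ₂
  | .string j, v => 0 < j ∧ j < m ∧ ComplexString hτ w v (m - j) m ∧ Complex.I * ((m : ℂ) - 2 * ((m - j : ℕ) : ℂ)) = μ₂

variable {hτ w}

/-- Transport of the dual complex types. [folklore] -/
theorem DualComplexTagged.map {m : ℕ} {μ₂ : ℂ} {Φ : Module.End ℂ (archGardingSpace hcpt τ)}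
    (h1 : ∀ i j : Fin 2, Commute Φ (D (Matrix.single i j 𝐜))) (h2 : ∀ i j : Fin 2, Commute Φ (D (Matrix.single i j 𝐜I)))
    (hR : Commute Φ (Rc)) :
    ∀ {t : ComplexTag} {v : archGardingSpace hcpt τ}, DualComplexTagged hτ w m μ₂ t v → DualComplexTagged hτ w m μ₂ t (Φ v)
  | .holPow _, _, ⟨h, hb⟩ => ⟨h.map w h1 h2 hR, hb⟩
  | .antiPowLowest _, _, ⟨h, hb⟩ => ⟨h.map w h1 h2 hR, hb⟩
  | .string _, _, ⟨hj, hjm, h, hb⟩ => ⟨hj, hjm, h.map w h1 h2 hR, hb⟩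

/-- `Ad`-identities of the Weyl rotation on the root letters: `R (E₀₁ ⊗ a) = -(E₁₀ ⊗ a) R` and
`R (E₁₀ ⊗ a) = -(E₀₁ ⊗ a) R` for `a ∈ {c_w, ic_w}`. [folklore] -/
theorem weylRotC_mul_single (a : ℂ) :
    ((expGL ((Real.pi / 2 : ℝ) • Jc) : GL (Fin 2) (mixedSpace K)) : Matrix (Fin 2) (Fin 2) (mixedSpace K)) *
        Matrix.single 0 1 ((0, Pi.single w a) : mixedSpace K) =
      -(Matrix.single 1 0 ((0, Pi.single w a) : mixedSpace K) *
        ((expGL ((Real.pi / 2 : ℝ) • Jc) : GL (Fin 2) (mixedSpace K)) : Matrix (Fin 2) (Fin 2) (mixedSpace K))) ∧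
    ((expGL ((Real.pi / 2 : ℝ) • Jc) : GL (Fin 2) (mixedSpace K)) : Matrix (Fin 2) (Fin 2) (mixedSpace K)) *
        Matrix.single 1 0 ((0, Pi.single w a) : mixedSpace K) =
      -(Matrix.single 0 1 ((0, Pi.single w a) : mixedSpace K) *
        ((expGL ((Real.pi / 2 : ℝ) • Jc) : GL (Fin 2) (mixedSpace K)) : Matrix (Fin 2) (Fin 2) (mixedSpace K))) := by
  have hca : 𝐜 * ((0, Pi.single w a) : mixedSpace K) = ((0, Pi.single w a) : mixedSpace K) := by
    rw [Prod.mk_mul_mk, mul_zero, ← Pi.single_mul, one_mul]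
  have hac : ((0, Pi.single w a) : mixedSpace K) * 𝐜 = ((0, Pi.single w a) : mixedSpace K) := by
    rw [Prod.mk_mul_mk, mul_zero, ← Pi.single_mul, mul_one]
  rw [coe_weylRotC]
  constructor <;>
  · simp only [add_mul, sub_mul, one_mul, mul_add, mul_sub, mul_one, single_mul_single_eq, hca, hac, neg_add, neg_sub]
    simp
    try abel

/-- Applied form of the `Ad`-identities: `R τ^{h}(E₀₁) v = -τ^{h}(E₁₀) R v`, `R τ^{a}(E₀₁) v = -τ^{a}(E₁₀) R v`,
`R τ^h(E₁₀) v = -τ^h(E₀₁) R v`, `R τ^a(E₁₀) v = -τ^a(E₀₁) R v`. [folklore] -/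
theorem weylRotC_letters_apply (v : archGardingSpace hcpt τ) :
    Rc (Dh[0,1] v) = -(Dh[1,0] (Rc v)) ∧ Rc (Da[0,1] v) = -(Da[1,0] (Rc v)) ∧
      Rc (Dh[1,0] v) = -(Dh[0,1] (Rc v)) ∧ Rc (Da[1,0] v) = -(Da[0,1] (Rc v)) := by
  have key : ∀ (a : ℂ) (u : archGardingSpace hcpt τ),
      Rc (D (Matrix.single 0 1 ((0, Pi.single w a) : mixedSpace K)) u) = -(D (Matrix.single 1 0 ((0, Pi.single w a) : mixedSpace K)) (Rc u)) ∧
      Rc (D (Matrix.single 1 0 ((0, Pi.single w a) : mixedSpace K)) u) = -(D (Matrix.single 0 1 ((0, Pi.single w a) : mixedSpace K)) (Rc u)) := by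
    intro a u
    obtain ⟨h01, h10⟩ := weylRotC_mul_single (w := w) a
    have conj : ∀ X Y : Matrix (Fin 2) (Fin 2) (mixedSpace K),
        ((expGL ((Real.pi / 2 : ℝ) • Jc) : GL (Fin 2) (mixedSpace K)) : Matrix (Fin 2) (Fin 2) (mixedSpace K)) * X =
          -(Y * ((expGL ((Real.pi / 2 : ℝ) • Jc) : GL (Fin 2) (mixedSpace K)) : Matrix (Fin 2) (Fin 2) (mixedSpace K))) →
        Rc (D X u) = -(D Y (Rc u)) := by
      intro X Y hXY
      have hc : ((expGL ((Real.pi / 2 : ℝ) • Jc) : GL (Fin 2) (mixedSpace K)) : Matrix (Fin 2) (Fin 2) (mixedSpace K)) * X *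
          (((expGL ((Real.pi / 2 : ℝ) • Jc))⁻¹ : GL (Fin 2) (mixedSpace K)) : Matrix (Fin 2) (Fin 2) (mixedSpace K)) = -Y := by
        rw [hXY, Matrix.neg_mul, Matrix.mul_assoc, ← Units.val_mul, mul_inv_cancel, Units.val_one, Matrix.mul_one]
      have h := congrArg (fun T => T u) (gardingAct_mul_gardingEnd (hcpt := hcpt) (τ := τ) hτ (expGL ((Real.pi / 2 : ℝ) • Jc)) X)
      simp only [Module.End.mul_apply] at h
      rw [h, hc, gardingEnd_neg, LinearMap.neg_apply]
    exact ⟨conj _ _ h01, conj _ _ h10⟩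
  obtain ⟨h1, h2⟩ := key 1 v
  obtain ⟨h3, h4⟩ := key Complex.I v
  refine ⟨?_, ?_, ?_, ?_⟩
  · rw [LinearMap.sub_apply, LinearMap.smul_apply, map_sub, map_smul, h1, h3, LinearMap.sub_apply, LinearMap.smul_apply, smul_neg]; abel
  · rw [LinearMap.add_apply, LinearMap.smul_apply, map_add, map_smul, h1, h3, LinearMap.add_apply, LinearMap.smul_apply, smul_neg]; abel
  · rw [LinearMap.sub_apply, LinearMap.smul_apply, map_sub, map_smul, h2, h4, LinearMap.sub_apply, LinearMap.smul_apply, smul_neg]; abel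
  · rw [LinearMap.add_apply, LinearMap.smul_apply, map_add, map_smul, h2, h4, LinearMap.add_apply, LinearMap.smul_apply, smul_neg]; abel

/-- `R E v = -F R v`, `R F v = -E R v`. [folklore] -/
theorem weylRotC_raisingK_loweringK_apply (v : archGardingSpace hcpt τ) :
    Rc ((Dh[0,1] - Da[1,0]) v) = -((Dh[1,0] - Da[0,1]) (Rc v)) ∧ Rc ((Dh[1,0] - Da[0,1]) v) = -((Dh[0,1] - Da[1,0]) (Rc v)) := by
  obtain ⟨h1, h2, h3, h4⟩ := weylRotC_letters_apply (hτ := hτ) (w := w) v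
  constructor
  · rw [show (Dh[0,1] - Da[1,0]) v = Dh[0,1] v - Da[1,0] v from rfl, map_sub, h1, h4,
      show (Dh[1,0] - Da[0,1]) (Rc v) = Dh[1,0] (Rc v) - Da[0,1] (Rc v) from rfl]
    abel
  · rw [show (Dh[1,0] - Da[0,1]) v = Dh[1,0] v - Da[0,1] v from rfl, map_sub, h3, h2,
      show (Dh[0,1] - Da[1,0]) (Rc v) = Dh[0,1] (Rc v) - Da[1,0] (Rc v) from rfl]
    abel

omit [CompleteSpace E] in
/-- Powers: `R T^b v = (-1)^b T'^b R v` when `R T u = -T' R u`. [folklore] -/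
theorem weylRot_pow_apply {R T T' : Module.End ℂ (archGardingSpace hcpt τ)} (h : ∀ u, R (T u) = -(T' (R u))) (b : ℕ)
    (v : archGardingSpace hcpt τ) : R ((T ^ b) v) = ((-1 : ℂ) ^ b) • (T' ^ b) (R v) := by
  induction b generalizing v with
  | zero => rw [pow_zero, pow_zero, pow_zero, Module.End.one_apply, Module.End.one_apply, one_smul]
  | succ b ih => rw [pow_succ, Module.End.mul_apply, ih, h, map_neg, smul_neg, ← neg_smul, pow_succ, mul_neg_one, pow_succ, Module.End.mul_apply]

/-- `τ^h(E₁₀)^b u = τ^a(E₀₁)^b u` when `F u = 0` (`F = τ^h(E₁₀) - τ^a(E₀₁)` commutes with `τ^a(E₀₁)`). [folklore] -/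
theorem hol10_pow_apply_of_loweringK {u : archGardingSpace hcpt τ} (hF : (Dh[1,0] - Da[0,1]) u = 0) (b : ℕ) :
    (Dh[1,0] ^ b) u = (Da[0,1] ^ b) u := by
  have hc : Commute (Dh[1,0]) (Da[0,1]) := gardingEndHol_comm_gardingEndAnti (hcpt := hcpt) (τ := τ) hτ w 1 0 0 1
  have hcomm : Commute (Dh[1,0] - Da[0,1]) (Da[0,1]) := hc.sub_left (Commute.refl _)
  induction b with
  | zero => rfl
  | succ b ih =>
    have h1 : (Dh[1,0] - Da[0,1]) ((Da[0,1] ^ b) u) = 0 := by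
      rw [← Module.End.mul_apply, (hcomm.pow_right b).eq, Module.End.mul_apply, hF, map_zero]
    rw [pow_succ', Module.End.mul_apply, ih, pow_succ', Module.End.mul_apply]
    rw [LinearMap.sub_apply, sub_eq_zero] at h1
    exact h1

/-- `τ^a(E₁₀)^b y = τ^h(E₀₁)^b y` when `E y = 0`. [folklore] -/
theorem anti10_pow_apply_of_raisingK {y : archGardingSpace hcpt τ} (hE : (Dh[0,1] - Da[1,0]) y = 0) (b : ℕ) :
    (Da[1,0] ^ b) y = (Dh[0,1] ^ b) y := by
  have hc : Commute (Dh[0,1]) (Da[1,0]) := gardingEndHol_comm_gardingEndAnti (hcpt := hcpt) (τ := τ) hτ w 0 1 1 0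
  have hcomm : Commute (Dh[0,1] - Da[1,0]) (Dh[0,1]) := (Commute.refl _).sub_left hc.symm
  induction b with
  | zero => rfl
  | succ b ih =>
    have h1 : (Dh[0,1] - Da[1,0]) ((Dh[0,1] ^ b) y) = 0 := by
      rw [← Module.End.mul_apply, (hcomm.pow_right b).eq, Module.End.mul_apply, hE, map_zero]
    rw [pow_succ', Module.End.mul_apply, ih, pow_succ', Module.End.mul_apply]
    rw [LinearMap.sub_apply, sub_eq_zero] at h1
    exact h1.symm

/-- `E^j F^m y = κ F^{m-j} y` with `κ ≠ 0`, `j ≤ m`, for a highest vector of weight `m`. [folklore] -/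
theorem exists_raisingK_pow_loweringK_pow {y : archGardingSpace hcpt τ} {m : ℕ} (hE : (Dh[0,1] - Da[1,0]) y = 0)
    (hT : D Tc y = (Complex.I * m) • y) : ∀ j : ℕ, j ≤ m →
    ∃ κ : ℂ, κ ≠ 0 ∧ ((Dh[0,1] - Da[1,0]) ^ j) (((Dh[1,0] - Da[0,1]) ^ m) y) = κ • ((Dh[1,0] - Da[0,1]) ^ (m - j)) y
  | 0, _ => ⟨1, one_ne_zero, by rw [pow_zero, Module.End.one_apply, Nat.sub_zero, one_smul]⟩
  | j + 1, hj => by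
    obtain ⟨κ, hκ, h⟩ := exists_raisingK_pow_loweringK_pow hE hT j (by omega)
    have hmj : m - j = (m - j - 1) + 1 := by omega
    refine ⟨κ * (4 * (((m - j - 1 : ℕ) : ℂ) + 1) * ((m : ℂ) - ((m - j - 1 : ℕ) : ℂ))), mul_ne_zero hκ ?_, ?_⟩
    · refine mul_ne_zero (mul_ne_zero (by norm_num) ?_) ?_
      · exact_mod_cast Nat.succ_ne_zero (m - j - 1)
      · rw [sub_ne_zero]; exact_mod_cast (show m ≠ m - j - 1 by omega)
    · rw [pow_succ', Module.End.mul_apply, h, map_smul,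
        show ((Dh[1,0] - Da[0,1]) ^ (m - j)) y = ((Dh[1,0] - Da[0,1]) ^ (m - j - 1 + 1)) y by rw [← hmj],
        raisingK_loweringK_pow_succ_apply hτ w m y hE hT (m - j - 1), smul_smul, show m - (j + 1) = m - j - 1 by omega]

/-- `exp(π E₀₀ ⊗ ic_w)` fixes a vector with `T v = it v`, `Z^I v = μ₂ v`, `it + μ₂ = 0`. [folklore] -/
theorem halfTurn_apply_of_torus {v : archGardingSpace hcpt τ} {t μ₂ : ℂ} (hT : D Tc v = (Complex.I * t) • v) (hZ2 : D Zc v = μ₂ • v)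
    (ht : Complex.I * t + μ₂ = 0) : Pπ v = v := by
  rw [gardingAct_expGL_cornerI_eq_exp_smul w hT hZ2, ht, zero_div, zero_mul, Complex.exp_zero, one_smul]

omit [NumberField K] in
/-- `ι_w(-1) = 1 - 2 c_w` in `K_∞`. [folklore] -/
theorem coe_complexUnitAt_neg_one :
    ((complexUnitAt K w (-1) : (mixedSpace K)ˣ) : mixedSpace K) = 1 + ((-1 : ℝ) - 1) • 𝐜 := by
  rw [coe_complexUnitAt, Units.val_neg, Units.val_one]
  refine Prod.ext (funext fun v => ?_) (funext fun v => ?_)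
  · simp
  · simp only [Prod.snd_add, Prod.snd_one, Prod.smul_snd, Pi.add_apply, Pi.one_apply, Pi.smul_apply]
    by_cases hv : v = w
    · subst hv; simp
    · simp [hv]

/-- **The square of the Weyl rotation is central**: `exp((π/2)J)² = exp(πJ) = diag(z, z)` with `z = ι_w(-1)`.
[folklore] -/
theorem weylRotC_sq : (expGL ((Real.pi / 2 : ℝ) • Jc) : GL (Fin 2) (mixedSpace K)) * expGL ((Real.pi / 2 : ℝ) • Jc) =
    diagGL2 (complexUnitAt K w (-1)) (complexUnitAt K w (-1)) := by
  open scoped Matrix.Norms.Operator in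
  obtain ⟨hJ, hP, -⟩ := complexPlace_matrix_facts (K := K) (w := w)
  rw [← expGL_add_smul, add_halves]
  refine Units.ext ?_
  rw [coe_expGL, exp_smul_eq_of_sq_eq_neg hJ hP, Real.cos_pi, Real.sin_pi, zero_smul, add_zero, coe_diagGL2, coe_complexUnitAt_neg_one]
  refine Matrix.ext fun i j => ?_
  fin_cases i <;> fin_cases j <;> simp [Matrix.single]

variable (hτu : τ.IsUnitary) {ℓ : archGardingSpace hcpt τ →ₗ[ℂ] ℂ} (hℓW : IsArchContWhittakerFunctional hcpt τ hτ ℓ)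
include hτu hℓW

/-- **The Weyl element at a complex place maps a tagged vector to a non-zero multiple of a dual-tagged vector.**
[cite: JacquetLanglands1970, §6 Thm. 6.4] -/
theorem exists_dual_of_complexTagged {m : ℕ} {μ₁ μ₂ lama lamh ν ν' : ℂ}
    (hlama : lama = (μ₁ + Complex.I * μ₂) ^ 2 / 2 - 2 * ν ^ 2 - 2)
    (hlamh : lamh = (μ₁ - Complex.I * μ₂) ^ 2 / 2 - 2 * ν' ^ 2 - 2)
    (hZ1 : ∀ v : archGardingSpace hcpt τ, D (Matrix.single 0 0 𝐜 + Matrix.single 1 1 𝐜) v = μ₁ • v)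
    (hZ2 : ∀ v : archGardingSpace hcpt τ, D Zc v = μ₂ • v)
    (hCa : ∀ v : archGardingSpace hcpt τ, ∑ i : Fin 2, ∑ j : Fin 2, Da[i,j] (Da[j,i] v) = lama • v)
    (hCh : ∀ v : archGardingSpace hcpt τ, ∑ i : Fin 2, ∑ j : Fin 2, Dh[i,j] (Dh[j,i] v) = lamh • v)
    (hrel : ∀ j : ℕ, 0 < j → j < m → lamh = (μ₁ - Complex.I * μ₂) ^ 2 / 2 - 2 * (ν - Complex.I * m) ^ 2 - 2)
    {s : ℂ} (hs : ∀ v : archGardingSpace hcpt τ, gardingAct hτ (diagGL2 (complexUnitAt K w (-1)) (complexUnitAt K w (-1))) v = s • v)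
    (hs0 : s ≠ 0) {t : ComplexTag} {v : archGardingSpace hcpt τ} (h : ComplexTagged hτ w m μ₂ t v) :
    ∃ c : ℂ, c ≠ 0 ∧ ∃ v' : archGardingSpace hcpt τ, DualComplexTagged hτ w m μ₂ t v' ∧ Rc (Pπ v) = c • v' := by
  have hR1 : ∀ u : archGardingSpace hcpt τ, Rc (Dh[0,1] u) = -(Dh[1,0] (Rc u)) := fun u => (weylRotC_letters_apply u).1
  have hR2 : ∀ u : archGardingSpace hcpt τ, Rc (Da[0,1] u) = -(Da[1,0] (Rc u)) := fun u => (weylRotC_letters_apply u).2.1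
  have hRF : ∀ u : archGardingSpace hcpt τ, Rc ((Dh[1,0] - Da[0,1]) u) = -((Dh[0,1] - Da[1,0]) (Rc u)) := fun u =>
    (weylRotC_raisingK_loweringK_apply u).2
  have hRR : ∀ u : archGardingSpace hcpt τ, Rc (Rc u) = s • u := fun u => by
    rw [← Module.End.mul_apply, ← gardingAct_mul, weylRotC_sq, hs]
  cases t with
  | holPow b =>
    obtain ⟨hhol, ht⟩ := h
    obtain ⟨hT, -⟩ := hhol.radial w hτu hℓW μ₁ μ₂ lama ν hlama hZ1 hZ2 hCa
    obtain ⟨y, hy, rfl⟩ := hhol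
    obtain ⟨hyE, hyT, hyF, c, hc, hRy⟩ := hy
    have hyF' : (Dh[1,0] - Da[0,1]) (((Dh[1,0] - Da[0,1]) ^ m) y) = 0 := by rw [← Module.End.mul_apply, ← pow_succ', hyF]
    refine ⟨(-1 : ℂ) ^ b * c, mul_ne_zero (pow_ne_zero _ (by norm_num)) hc, (Da[0,1] ^ b) (((Dh[1,0] - Da[0,1]) ^ m) y),
      ⟨⟨y, ⟨hyE, hyT, hyF, c, hc, hRy⟩, rfl⟩, by linear_combination -ht⟩, ?_⟩
    rw [halfTurn_apply_of_torus hT (hZ2 _) ht, weylRot_pow_apply hR1, hRy, map_smul, hol10_pow_apply_of_loweringK hyF', smul_smul]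
  | antiPowLowest b =>
    obtain ⟨hanti, ht⟩ := h
    obtain ⟨hT, -⟩ := hanti.radial w hτu hℓW μ₁ μ₂ lamh ν' hlamh hZ1 hZ2 hCh
    obtain ⟨y, hy, rfl⟩ := hanti
    obtain ⟨hyE, hyT, hyF, c, hc, hRy⟩ := hy
    have hRlow : Rc (((Dh[1,0] - Da[0,1]) ^ m) y) = (s / c) • y := by
      have h1 : Rc (Rc y) = c • Rc (((Dh[1,0] - Da[0,1]) ^ m) y) := by rw [hRy, map_smul]
      rw [hRR] at h1
      rw [show s / c = c⁻¹ * s by rw [div_eq_mul_inv, mul_comm], mul_smul, h1, smul_smul, inv_mul_cancel₀ hc, one_smul]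
    refine ⟨(-1 : ℂ) ^ b * (s / c), mul_ne_zero (pow_ne_zero _ (by norm_num)) (div_ne_zero hs0 hc), (Dh[0,1] ^ b) y,
      ⟨⟨y, ⟨hyE, hyT, hyF, c, hc, hRy⟩, rfl⟩, by linear_combination -ht⟩, ?_⟩
    rw [halfTurn_apply_of_torus hT (hZ2 _) ht, weylRot_pow_apply hR2, hRlow, map_smul, anti10_pow_apply_of_raisingK hyE, smul_smul]
  | string j =>
    obtain ⟨hj, hjm, hstr, ht⟩ := h
    obtain ⟨hT, -⟩ := hstr.radial w hτu hℓW μ₁ μ₂ lama lamh ν hlama (hrel j hj hjm) hZ1 hZ2 hCa hCh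
    obtain ⟨-, y, hy, rfl⟩ := hstr
    obtain ⟨hyE, hyT, hyF, c, hc, hRy⟩ := hy
    obtain ⟨κ, hκ, hEF⟩ := exists_raisingK_pow_loweringK_pow hyE hyT j hjm.le
    refine ⟨(-1 : ℂ) ^ j * (c * κ), mul_ne_zero (pow_ne_zero _ (by norm_num)) (mul_ne_zero hc hκ), ((Dh[1,0] - Da[0,1]) ^ (m - j)) y,
      ⟨hj, hjm, ⟨Nat.sub_le _ _, y, ⟨hyE, hyT, hyF, c, hc, hRy⟩, rfl⟩, ?_⟩, ?_⟩
    · rw [Nat.cast_sub hjm.le]; linear_combination -ht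
    · rw [halfTurn_apply_of_torus hT (hZ2 _) ht, weylRot_pow_apply hRF, hRy, map_smul, hEF, smul_smul, smul_smul, mul_assoc]

end ComplexPlace

/-! ### 3. The place Weyl elements: components and commutation with the other places -/

section WeylElements

variable (K)

/-- The real place Weyl element `g_w = exp((π/2)W_w) δ_w = ι_w(w₂)`, `w₂ = (0 1; 1 0)`. [folklore] -/
def realWeylGL (w : {w : InfinitePlace K // IsReal w}) : GL (Fin 2) (mixedSpace K) := realPlaceGL K w (rotGLR (Real.pi / 2) * reflGLR)

/-- The complex place Weyl element `g_w = exp((π/2)J_w) exp(π E₀₀ ⊗ ic_w) = ι_w(w₂)`. [folklore] -/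
def complexWeylGL (w : {w : InfinitePlace K // IsComplex w}) : GL (Fin 2) (mixedSpace K) :=
  complexPlaceGL K w (rotGLC (Real.pi / 2) * phase0GLC Real.pi)

variable {K}

omit [NumberField K] in
/-- `rot(π/2) · refl = w₂` in `GL₂(ℝ)`. [folklore] -/
theorem coe_rotGLR_mul_reflGLR : ((rotGLR (Real.pi / 2) * reflGLR : GL (Fin 2) ℝ) : Matrix (Fin 2) (Fin 2) ℝ) = !![0, 1; 1, 0] := by
  rw [Units.val_mul, coe_rotGLR, coe_reflGLR, Real.cos_pi_div_two, Real.sin_pi_div_two]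
  ext i j; fin_cases i <;> fin_cases j <;> simp

omit [NumberField K] in
/-- `rot(π/2) · diag(e^{iπ}, 1) = w₂` in `GL₂(ℂ)`. [folklore] -/
theorem coe_rotGLC_mul_phase0GLC : ((rotGLC (Real.pi / 2) * phase0GLC Real.pi : GL (Fin 2) ℂ) : Matrix (Fin 2) (Fin 2) ℂ) = !![0, 1; 1, 0] := by
  rw [Units.val_mul, coe_rotGLC, coe_phase0GLC, Real.cos_pi_div_two, Real.sin_pi_div_two, Complex.exp_pi_mul_I]
  ext i j; fin_cases i <;> fin_cases j <;> simp

/-- `realWeylGL = exp((π/2)W_w) * realPlaceGL refl`. [folklore] -/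
theorem realWeylGL_eq (w : {w : InfinitePlace K // IsReal w}) : realWeylGL K w =
    expGL ((Real.pi / 2 : ℝ) • (Matrix.single (0 : Fin 2) (1 : Fin 2) ((Pi.single w 1, 0) : mixedSpace K) - Matrix.single 1 0 ((Pi.single w 1, 0) : mixedSpace K))) *
      realPlaceGL K w reflGLR := by
  rw [realWeylGL, map_mul, realPlaceGL_rotGLR]

/-- `complexWeylGL = exp((π/2)J_w) * exp(π E₀₀ ⊗ ic_w)`. [folklore] -/
theorem complexWeylGL_eq (w : {w : InfinitePlace K // IsComplex w}) : complexWeylGL K w =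
    expGL ((Real.pi / 2 : ℝ) • (Matrix.single (0 : Fin 2) (1 : Fin 2) ((0, Pi.single w 1) : mixedSpace K) - Matrix.single 1 0 ((0, Pi.single w 1) : mixedSpace K))) *
      expGL ((Real.pi : ℝ) • Matrix.single (0 : Fin 2) (0 : Fin 2) ((0, Pi.single w Complex.I) : mixedSpace K)) := by
  rw [complexWeylGL, map_mul, complexPlaceGL_rotGLC, complexPlaceGL_phase0GLC]

omit [NumberField K] in
/-- Components of the long Weyl element. [folklore] -/
theorem eval_weylLong :
    (∀ v : {w : InfinitePlace K // IsReal w}, (mixedSpaceEvalReal K v).mapMatrix ((weylLong 2 (mixedSpace K) : GL (Fin 2) (mixedSpace K)) :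
      Matrix (Fin 2) (Fin 2) (mixedSpace K)) = !![0, 1; 1, 0]) ∧
    ∀ v : {w : InfinitePlace K // IsComplex w}, (mixedSpaceEvalComplex K v).mapMatrix ((weylLong 2 (mixedSpace K) : GL (Fin 2) (mixedSpace K)) :
      Matrix (Fin 2) (Fin 2) (mixedSpace K)) = !![0, 1; 1, 0] := by
  constructor <;> intro v <;>
  · ext i j
    rw [RingHom.mapMatrix_apply, Matrix.map_apply, coe_weylLong]
    fin_cases i <;> fin_cases j <;> simp [Equiv.Perm.permMatrix, PEquiv.toMatrix_apply]

end WeylElements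

section WeylCommute

variable {hcpt : isCompact_glFiniteIntegralLevel 2 K}
  {E : Type*} [NormedAddCommGroup E] [InnerProductSpace ℂ E] [CompleteSpace E]
  {τ : ContRepresentation ℂ (AutomorphyDatum.gl 2 K hcpt).arch.carrier E}
  (hτ : τ.IsStronglyContinuous)

local notation "D" => gardingEnd (hcpt := hcpt) (τ := τ) hτ

/-- **The Weyl element of a real place commutes with the other places.** [folklore] -/
theorem commute_gardingAct_realWeylGL (w : {w : InfinitePlace K // IsReal w}) :
    (∀ w', w' ≠ w → (∀ i j : Fin 2, Commute (gardingAct hτ (realWeylGL K w)) (D (Matrix.single i j ((Pi.single w' 1, 0) : mixedSpace K)))) ∧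
      Commute (gardingAct hτ (realWeylGL K w)) (gardingAct hτ (realPlaceGL K w' reflGLR))) ∧
    ∀ w' : {w : InfinitePlace K // IsComplex w},
      (∀ i j : Fin 2, Commute (gardingAct hτ (realWeylGL K w)) (D (Matrix.single i j ((0, Pi.single w' 1) : mixedSpace K)))) ∧
      (∀ i j : Fin 2, Commute (gardingAct hτ (realWeylGL K w)) (D (Matrix.single i j ((0, Pi.single w' Complex.I) : mixedSpace K)))) ∧
      Commute (gardingAct hτ (realWeylGL K w)) (gardingAct hτ (expGL ((Real.pi / 2 : ℝ) •
        (Matrix.single (0 : Fin 2) (1 : Fin 2) ((0, Pi.single w' 1) : mixedSpace K) - Matrix.single (1 : Fin 2) (0 : Fin 2) ((0, Pi.single w' 1) : mixedSpace K))))) := by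
  obtain ⟨hrc, hcc, hrr⟩ := place_coeff_mul_eq_zero (K := K)
  have hδ := coe_realPlaceGL_reflGLR (K := K) w
  -- matrix commutations of `W_w`
  have hW : ∀ (y : mixedSpace K), ((Pi.single w 1, 0) : mixedSpace K) * y = 0 → y * ((Pi.single w 1, 0) : mixedSpace K) = 0 →
      ∀ k l : Fin 2, Commute ((Real.pi / 2 : ℝ) • (Matrix.single (0 : Fin 2) (1 : Fin 2) ((Pi.single w 1, 0) : mixedSpace K) -
        Matrix.single 1 0 ((Pi.single w 1, 0) : mixedSpace K))) (Matrix.single k l y) := fun y h1 h2 k l =>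
    ((commute_single_of_mul_eq_zero h1 h2 0 1 k l).sub_left (commute_single_of_mul_eq_zero h1 h2 1 0 k l)).smul_left _
  rw [realWeylGL_eq, gardingAct_mul]
  refine ⟨fun w' hw' => ⟨fun i j => ?_, ?_⟩, fun w' => ⟨fun i j => ?_, fun i j => ?_, ?_⟩⟩
  · exact Commute.mul_left (commute_gardingAct_expGL_gardingEnd hτ (hW _ (hrr w w' (Ne.symm hw')) (hrr w' w hw') i j))
      ((commute_gardingAct_realSign_letters hτ hδ).1 w' hw' i j)
  · refine Commute.mul_left (commute_gardingAct_of_coe hτ ?_) (commute_gardingAct_realSign (hτ := hτ) (δf := fun v => realPlaceGL K v reflGLR)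
      (fun v => coe_realPlaceGL_reflGLR (K := K) v) w w')
    rw [coe_expGL, coe_realPlaceGL_reflGLR]
    exact ((Commute.one_right _).sub_right ((hW _ (hrr w w' (Ne.symm hw')) (hrr w' w hw') 0 0).smul_right _)).exp_left
  · exact Commute.mul_left (commute_gardingAct_expGL_gardingEnd hτ (hW _ (hrc w w' 1).1 (hrc w w' 1).2 i j))
      ((commute_gardingAct_realSign_letters hτ hδ).2 w' 1 i j)
  · exact Commute.mul_left (commute_gardingAct_expGL_gardingEnd hτ (hW _ (hrc w w' Complex.I).1 (hrc w w' Complex.I).2 i j))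
      ((commute_gardingAct_realSign_letters hτ hδ).2 w' Complex.I i j)
  · refine Commute.mul_left (commute_gardingAct_of_coe hτ ?_) ?_
    · rw [coe_expGL, coe_expGL]
      exact (((hW _ (hrc w w' 1).1 (hrc w w' 1).2 0 1).sub_right (hW _ (hrc w w' 1).1 (hrc w w' 1).2 1 0)).smul_right _).exp_left.exp_right
    · exact (commute_placeGens hτ (δf := fun v => realPlaceGL K v reflGLR) (fun v => coe_realPlaceGL_reflGLR (K := K) v)).2.2.2.1 w w' _
        (Or.inr rfl)

/-- **The Weyl element of a complex place commutes with the other places.** [folklore] -/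
theorem commute_gardingAct_complexWeylGL (w : {w : InfinitePlace K // IsComplex w}) :
    (∀ w' : {w : InfinitePlace K // IsReal w}, (∀ i j : Fin 2, Commute (gardingAct hτ (complexWeylGL K w)) (D (Matrix.single i j ((Pi.single w' 1, 0) : mixedSpace K)))) ∧
      Commute (gardingAct hτ (complexWeylGL K w)) (gardingAct hτ (realPlaceGL K w' reflGLR))) ∧
    ∀ w', w' ≠ w →
      (∀ i j : Fin 2, Commute (gardingAct hτ (complexWeylGL K w)) (D (Matrix.single i j ((0, Pi.single w' 1) : mixedSpace K)))) ∧
      (∀ i j : Fin 2, Commute (gardingAct hτ (complexWeylGL K w)) (D (Matrix.single i j ((0, Pi.single w' Complex.I) : mixedSpace K)))) ∧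
      Commute (gardingAct hτ (complexWeylGL K w)) (gardingAct hτ (expGL ((Real.pi / 2 : ℝ) •
        (Matrix.single (0 : Fin 2) (1 : Fin 2) ((0, Pi.single w' 1) : mixedSpace K) - Matrix.single (1 : Fin 2) (0 : Fin 2) ((0, Pi.single w' 1) : mixedSpace K))))) := by
  obtain ⟨hrc, hcc, hrr⟩ := place_coeff_mul_eq_zero (K := K)
  have hJ : ∀ (y : mixedSpace K), ((0, Pi.single w 1) : mixedSpace K) * y = 0 → y * ((0, Pi.single w 1) : mixedSpace K) = 0 →
      ∀ k l : Fin 2, Commute ((Real.pi / 2 : ℝ) • (Matrix.single (0 : Fin 2) (1 : Fin 2) ((0, Pi.single w 1) : mixedSpace K) -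
        Matrix.single 1 0 ((0, Pi.single w 1) : mixedSpace K))) (Matrix.single k l y) := fun y h1 h2 k l =>
    ((commute_single_of_mul_eq_zero h1 h2 0 1 k l).sub_left (commute_single_of_mul_eq_zero h1 h2 1 0 k l)).smul_left _
  have hP : ∀ (y : mixedSpace K), ((0, Pi.single w Complex.I) : mixedSpace K) * y = 0 → y * ((0, Pi.single w Complex.I) : mixedSpace K) = 0 →
      ∀ k l : Fin 2, Commute ((Real.pi : ℝ) • Matrix.single (0 : Fin 2) (0 : Fin 2) ((0, Pi.single w Complex.I) : mixedSpace K)) (Matrix.single k l y) :=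
    fun y h1 h2 k l => (commute_single_of_mul_eq_zero h1 h2 0 0 k l).smul_left _
  have hrc' : ∀ (w' : {w : InfinitePlace K // IsReal w}) (a : ℂ), ((0, Pi.single w a) : mixedSpace K) * ((Pi.single w' 1, 0) : mixedSpace K) = 0 ∧
      ((Pi.single w' 1, 0) : mixedSpace K) * ((0, Pi.single w a) : mixedSpace K) = 0 := fun w' a => ⟨(hrc w' w a).2, (hrc w' w a).1⟩
  rw [complexWeylGL_eq, gardingAct_mul]
  refine ⟨fun w' => ⟨fun i j => ?_, ?_⟩, fun w' hw' => ⟨fun i j => ?_, fun i j => ?_, ?_⟩⟩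
  · exact Commute.mul_left (commute_gardingAct_expGL_gardingEnd hτ (hJ _ (hrc' w' 1).1 (hrc' w' 1).2 i j))
      (commute_gardingAct_expGL_gardingEnd hτ (hP _ (hrc' w' Complex.I).1 (hrc' w' Complex.I).2 i j))
  · refine Commute.mul_left (commute_gardingAct_of_coe hτ ?_) (commute_gardingAct_of_coe hτ ?_)
    · rw [coe_expGL, coe_realPlaceGL_reflGLR]
      exact ((Commute.one_right _).sub_right ((hJ _ (hrc' w' 1).1 (hrc' w' 1).2 0 0).smul_right _)).exp_left
    · rw [coe_expGL, coe_realPlaceGL_reflGLR]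
      exact ((Commute.one_right _).sub_right ((hP _ (hrc' w' Complex.I).1 (hrc' w' Complex.I).2 0 0).smul_right _)).exp_left
  · exact Commute.mul_left (commute_gardingAct_expGL_gardingEnd hτ (hJ _ (hcc w w' 1 1 (Ne.symm hw')) (hcc w' w 1 1 hw') i j))
      (commute_gardingAct_expGL_gardingEnd hτ (hP _ (hcc w w' Complex.I 1 (Ne.symm hw')) (hcc w' w 1 Complex.I hw') i j))
  · exact Commute.mul_left (commute_gardingAct_expGL_gardingEnd hτ (hJ _ (hcc w w' 1 Complex.I (Ne.symm hw')) (hcc w' w Complex.I 1 hw') i j))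
      (commute_gardingAct_expGL_gardingEnd hτ (hP _ (hcc w w' Complex.I Complex.I (Ne.symm hw')) (hcc w' w Complex.I Complex.I hw') i j))
  · refine Commute.mul_left (commute_gardingAct_of_coe hτ ?_) (commute_gardingAct_of_coe hτ ?_)
    · rw [coe_expGL, coe_expGL]
      exact (((hJ _ (hcc w w' 1 1 (Ne.symm hw')) (hcc w' w 1 1 hw') 0 1).sub_right
        (hJ _ (hcc w w' 1 1 (Ne.symm hw')) (hcc w' w 1 1 hw') 1 0)).smul_right _).exp_left.exp_right
    · rw [coe_expGL, coe_expGL]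
      exact (((hP _ (hcc w w' Complex.I 1 (Ne.symm hw')) (hcc w' w 1 Complex.I hw') 0 1).sub_right
        (hP _ (hcc w w' Complex.I 1 (Ne.symm hw')) (hcc w' w 1 Complex.I hw') 1 0)).smul_right _).exp_left.exp_right

end WeylCommute

/-! ### 4. `τ(w_L) e = c z` with `z` dual-tagged at all places -/

section DualVector

variable {hcpt : isCompact_glFiniteIntegralLevel 2 K}
  {E : Type*} [NormedAddCommGroup E] [InnerProductSpace ℂ E] [CompleteSpace E]
  {τ : ContRepresentation ℂ (AutomorphyDatum.gl 2 K hcpt).arch.carrier E}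
  (hτ : τ.IsStronglyContinuous)

local notation "D" => gardingEnd (hcpt := hcpt) (τ := τ) hτ

omit [NumberField K] in
/-- Components of the real place Weyl element. [folklore] -/
theorem eval_realWeylGL (w : {w : InfinitePlace K // IsReal w}) :
    (∀ v, (mixedSpaceEvalReal K v).mapMatrix ((realWeylGL K w : GL (Fin 2) (mixedSpace K)) : Matrix (Fin 2) (Fin 2) (mixedSpace K)) =
      if v = w then !![0, 1; 1, 0] else 1) ∧
    ∀ v, (mixedSpaceEvalComplex K v).mapMatrix ((realWeylGL K w : GL (Fin 2) (mixedSpace K)) : Matrix (Fin 2) (Fin 2) (mixedSpace K)) = 1 :=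
  ⟨fun v => by rw [realWeylGL, evalReal_coe_realPlaceGL, coe_rotGLR_mul_reflGLR], fun v => evalComplex_coe_realPlaceGL K v w _⟩

omit [NumberField K] in
/-- Components of the complex place Weyl element. [folklore] -/
theorem eval_complexWeylGL (w : {w : InfinitePlace K // IsComplex w}) :
    (∀ v, (mixedSpaceEvalReal K v).mapMatrix ((complexWeylGL K w : GL (Fin 2) (mixedSpace K)) : Matrix (Fin 2) (Fin 2) (mixedSpace K)) = 1) ∧
    ∀ v, (mixedSpaceEvalComplex K v).mapMatrix ((complexWeylGL K w : GL (Fin 2) (mixedSpace K)) : Matrix (Fin 2) (Fin 2) (mixedSpace K)) =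
      if v = w then !![0, 1; 1, 0] else 1 :=
  ⟨fun v => evalReal_coe_complexPlaceGL K v w _, fun v => by rw [complexWeylGL, evalComplex_coe_complexPlaceGL, coe_rotGLC_mul_phase0GLC]⟩

variable (hτu : τ.IsUnitary) {ℓ : archGardingSpace hcpt τ →ₗ[ℂ] ℂ} (hℓW : IsArchContWhittakerFunctional hcpt τ hτ ℓ)
  -- real place scalars
  {μR lamR νR : {w : InfinitePlace K // IsReal w} → ℂ} (hlamR : ∀ w, lamR w = μR w ^ 2 / 2 - 2 * νR w ^ 2 - 1 / 2)
  -- complex place scalars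
  {mx : {w : InfinitePlace K // IsComplex w} → ℕ} {μ₁ μ₂ lama lamh νC νC' sC : {w : InfinitePlace K // IsComplex w} → ℂ}
  (hlama : ∀ w, lama w = (μ₁ w + Complex.I * μ₂ w) ^ 2 / 2 - 2 * νC w ^ 2 - 2)
  (hlamh : ∀ w, lamh w = (μ₁ w - Complex.I * μ₂ w) ^ 2 / 2 - 2 * νC' w ^ 2 - 2)
  (hZ1 : ∀ w (v : archGardingSpace hcpt τ), gardingEnd hτ (Matrix.single 0 0 ((0, Pi.single w 1) : mixedSpace K) +
    Matrix.single 1 1 ((0, Pi.single w 1) : mixedSpace K)) v = μ₁ w • v)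
  (hZ2 : ∀ w (v : archGardingSpace hcpt τ), gardingEnd hτ (Matrix.single 0 0 ((0, Pi.single w Complex.I) : mixedSpace K) +
    Matrix.single 1 1 ((0, Pi.single w Complex.I) : mixedSpace K)) v = μ₂ w • v)
  (hCa : ∀ w (v : archGardingSpace hcpt τ), ∑ i : Fin 2, ∑ j : Fin 2,
    (gardingEnd hτ (Matrix.single i j ((0, Pi.single w 1) : mixedSpace K)) + Complex.I • gardingEnd hτ (Matrix.single i j ((0, Pi.single w Complex.I) : mixedSpace K)))
      ((gardingEnd hτ (Matrix.single j i ((0, Pi.single w 1) : mixedSpace K)) + Complex.I • gardingEnd hτ (Matrix.single j i ((0, Pi.single w Complex.I) : mixedSpace K))) v) = lama w • v)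
  (hCh : ∀ w (v : archGardingSpace hcpt τ), ∑ i : Fin 2, ∑ j : Fin 2,
    (gardingEnd hτ (Matrix.single i j ((0, Pi.single w 1) : mixedSpace K)) - Complex.I • gardingEnd hτ (Matrix.single i j ((0, Pi.single w Complex.I) : mixedSpace K)))
      ((gardingEnd hτ (Matrix.single j i ((0, Pi.single w 1) : mixedSpace K)) - Complex.I • gardingEnd hτ (Matrix.single j i ((0, Pi.single w Complex.I) : mixedSpace K))) v) = lamh w • v)
  (hrel : ∀ w (j : ℕ), 0 < j → j < mx w → lamh w = (μ₁ w - Complex.I * μ₂ w) ^ 2 / 2 - 2 * (νC w - Complex.I * mx w) ^ 2 - 2)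
  (hsC : ∀ w (v : archGardingSpace hcpt τ), gardingAct hτ (diagGL2 (complexUnitAt K w (-1)) (complexUnitAt K w (-1))) v = sC w • v)
  (hsC0 : ∀ w, sC w ≠ 0)

include hτu hℓW hlamR hlama hlamh hZ1 hZ2 hCa hCh hrel hsC hsC0

/-- **`τ(w_L) e = c · z` with `c ≠ 0` and `z` of the dual types at all places**, for a vector `e` of tagged final
types at all places (induction over the places, `w_L = ∏_w g_w`). [cite: JacquetLanglands1970, §5 Thm. 5.15, §6 Thm. 6.4, proof of Thm. 11.1] -/
theorem exists_dual_vector (tagR : {w : InfinitePlace K // IsReal w} → RealTag) (tagC : {w : InfinitePlace K // IsComplex w} → ComplexTag)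
    {e : archGardingSpace hcpt τ} (hR : ∀ w, RealTagged hτ w (realPlaceGL K w reflGLR) (μR w) (lamR w) (tagR w) e)
    (hC : ∀ w, ComplexTagged hτ w (mx w) (μ₂ w) (tagC w) e) :
    ∃ c : ℂ, c ≠ 0 ∧ ∃ z : archGardingSpace hcpt τ, (∀ w, DualRealTagged hτ w (realPlaceGL K w reflGLR) (μR w) (lamR w) (tagR w) z) ∧
      (∀ w, DualComplexTagged hτ w (mx w) (μ₂ w) (tagC w) z) ∧ gardingAct hτ (weylLong 2 (mixedSpace K)) e = c • z := by
  have hδ : ∀ w : {w : InfinitePlace K // IsReal w}, ((realPlaceGL K w reflGLR : GL (Fin 2) (mixedSpace K)) : Matrix (Fin 2) (Fin 2) (mixedSpace K)) =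
      1 - (2 : ℝ) • Matrix.single (0 : Fin 2) (0 : Fin 2) ((Pi.single w 1, 0) : mixedSpace K) := fun w => coe_realPlaceGL_reflGLR (K := K) w
  have key : ∀ s : Finset ({w : InfinitePlace K // IsReal w} ⊕ {w : InfinitePlace K // IsComplex w}),
      ∃ G : GL (Fin 2) (mixedSpace K),
        (∀ v, (mixedSpaceEvalReal K v).mapMatrix (G : Matrix (Fin 2) (Fin 2) (mixedSpace K)) = if Sum.inl v ∈ s then !![0, 1; 1, 0] else 1) ∧
        (∀ v, (mixedSpaceEvalComplex K v).mapMatrix (G : Matrix (Fin 2) (Fin 2) (mixedSpace K)) = if Sum.inr v ∈ s then !![0, 1; 1, 0] else 1) ∧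
        ∃ c : ℂ, c ≠ 0 ∧ ∃ z : archGardingSpace hcpt τ,
          (∀ w, Sum.inl w ∈ s → DualRealTagged hτ w (realPlaceGL K w reflGLR) (μR w) (lamR w) (tagR w) z) ∧
          (∀ w, Sum.inl w ∉ s → RealTagged hτ w (realPlaceGL K w reflGLR) (μR w) (lamR w) (tagR w) z) ∧
          (∀ w, Sum.inr w ∈ s → DualComplexTagged hτ w (mx w) (μ₂ w) (tagC w) z) ∧
          (∀ w, Sum.inr w ∉ s → ComplexTagged hτ w (mx w) (μ₂ w) (tagC w) z) ∧
          gardingAct hτ G e = c • z := by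
    intro s
    induction s using Finset.induction_on with
    | empty =>
      refine ⟨1, fun v => ?_, fun v => ?_, 1, one_ne_zero, e, fun w h => absurd h (Finset.notMem_empty _), fun w _ => hR w,
        fun w h => absurd h (Finset.notMem_empty _), fun w _ => hC w, by rw [gardingAct_one, Module.End.one_apply, one_smul]⟩
      · rw [Units.val_one, map_one, if_neg (Finset.notMem_empty _)]
      · rw [Units.val_one, map_one, if_neg (Finset.notMem_empty _)]
    | @insert i s hi ih =>
      obtain ⟨G, hGR, hGC, c, hc, z, hRd, hRt, hCd, hCt, hGe⟩ := ih
      rcases i with w | w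
      · -- a real place
        obtain ⟨hcR, hcC⟩ := commute_gardingAct_realWeylGL hτ w
        obtain ⟨cw, hcw, z', hz', hgz⟩ := exists_dual_of_realTagged (hδ w) hτu hℓW (νR w) (hlamR w) (hRt w hi)
        have hgz' : gardingAct hτ (realWeylGL K w) z = cw • z' := by rw [realWeylGL_eq, gardingAct_mul, Module.End.mul_apply, hgz]
        set Φ : Module.End ℂ (archGardingSpace hcpt τ) := cw⁻¹ • gardingAct hτ (realWeylGL K w) with hΦ
        have hz'Φ : z' = Φ z := by rw [hΦ, LinearMap.smul_apply, hgz', smul_smul, inv_mul_cancel₀ hcw, one_smul]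
        refine ⟨realWeylGL K w * G, fun v => ?_, fun v => ?_, c * cw, mul_ne_zero hc hcw, z', fun w' hw' => ?_, fun w' hw' => ?_,
          fun w' hw' => ?_, fun w' hw' => ?_, ?_⟩
        · rw [Units.val_mul, map_mul, (eval_realWeylGL w).1 v, hGR v]
          by_cases hvw : v = w
          · subst hvw; rw [if_pos rfl, if_neg hi, if_pos (Finset.mem_insert_self _ _), mul_one]
          · rw [if_neg hvw, one_mul]
            by_cases hv : Sum.inl v ∈ s
            · rw [if_pos hv, if_pos (Finset.mem_insert_of_mem hv)]
            · rw [if_neg hv, if_neg (fun h => by rcases Finset.mem_insert.mp h with h | h <;> [exact hvw (Sum.inl_injective h); exact hv h])]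
        · rw [Units.val_mul, map_mul, (eval_realWeylGL w).2 v, hGC v, one_mul]
          by_cases hv : Sum.inr v ∈ s
          · rw [if_pos hv, if_pos (Finset.mem_insert_of_mem hv)]
          · rw [if_neg hv, if_neg (fun h => by rcases Finset.mem_insert.mp h with h | h <;> [cases h; exact hv h])]
        · rcases Finset.mem_insert.mp hw' with h | h
          · cases h; exact hz'
          · have hne : w' ≠ w := fun e => hi (e ▸ h)
            rw [hz'Φ]
            exact (hRd w' h).map (fun k l => ((hcR w' hne).1 k l).smul_left _) ((hcR w' hne).2.smul_left _)
        · have hne : w' ≠ w := fun e => hw' (Finset.mem_insert.mpr (Or.inl (by rw [e])))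
          rw [hz'Φ]
          exact (hRt w' fun h => hw' (Finset.mem_insert_of_mem h)).map (fun k l => ((hcR w' hne).1 k l).smul_left _) ((hcR w' hne).2.smul_left _)
        · have h : Sum.inr w' ∈ s := by simpa using hw'
          rw [hz'Φ]
          exact (hCd w' h).map (fun k l => ((hcC w').1 k l).smul_left _) (fun k l => ((hcC w').2.1 k l).smul_left _) ((hcC w').2.2.smul_left _)
        · rw [hz'Φ]
          exact (hCt w' fun h => hw' (Finset.mem_insert_of_mem h)).map (fun k l => ((hcC w').1 k l).smul_left _)
            (fun k l => ((hcC w').2.1 k l).smul_left _) ((hcC w').2.2.smul_left _)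
        · rw [gardingAct_mul, Module.End.mul_apply, hGe, map_smul, hgz', smul_smul]
      · -- a complex place
        obtain ⟨hcR, hcC⟩ := commute_gardingAct_complexWeylGL hτ w
        obtain ⟨cw, hcw, z', hz', hgz⟩ := exists_dual_of_complexTagged hτu hℓW (hlama w) (hlamh w) (hZ1 w) (hZ2 w) (hCa w) (hCh w) (hrel w)
          (hsC w) (hsC0 w) (hCt w hi)
        have hgz' : gardingAct hτ (complexWeylGL K w) z = cw • z' := by rw [complexWeylGL_eq, gardingAct_mul, Module.End.mul_apply, hgz]
        set Φ : Module.End ℂ (archGardingSpace hcpt τ) := cw⁻¹ • gardingAct hτ (complexWeylGL K w) with hΦ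
        have hz'Φ : z' = Φ z := by rw [hΦ, LinearMap.smul_apply, hgz', smul_smul, inv_mul_cancel₀ hcw, one_smul]
        refine ⟨complexWeylGL K w * G, fun v => ?_, fun v => ?_, c * cw, mul_ne_zero hc hcw, z', fun w' hw' => ?_, fun w' hw' => ?_,
          fun w' hw' => ?_, fun w' hw' => ?_, ?_⟩
        · rw [Units.val_mul, map_mul, (eval_complexWeylGL w).1 v, hGR v, one_mul]
          by_cases hv : Sum.inl v ∈ s
          · rw [if_pos hv, if_pos (Finset.mem_insert_of_mem hv)]
          · rw [if_neg hv, if_neg (fun h => by rcases Finset.mem_insert.mp h with h | h <;> [cases h; exact hv h])]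
        · rw [Units.val_mul, map_mul, (eval_complexWeylGL w).2 v, hGC v]
          by_cases hvw : v = w
          · subst hvw; rw [if_pos rfl, if_neg hi, if_pos (Finset.mem_insert_self _ _), mul_one]
          · rw [if_neg hvw, one_mul]
            by_cases hv : Sum.inr v ∈ s
            · rw [if_pos hv, if_pos (Finset.mem_insert_of_mem hv)]
            · rw [if_neg hv, if_neg (fun h => by rcases Finset.mem_insert.mp h with h | h <;> [exact hvw (Sum.inr_injective h); exact hv h])]
        · have h : Sum.inl w' ∈ s := by simpa using hw'
          rw [hz'Φ]
          exact (hRd w' h).map (fun k l => ((hcR w').1 k l).smul_left _) ((hcR w').2.smul_left _)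
        · rw [hz'Φ]
          exact (hRt w' fun h => hw' (Finset.mem_insert_of_mem h)).map (fun k l => ((hcR w').1 k l).smul_left _) ((hcR w').2.smul_left _)
        · rcases Finset.mem_insert.mp hw' with h | h
          · cases h; exact hz'
          · have hne : w' ≠ w := fun e => hi (e ▸ h)
            rw [hz'Φ]
            exact (hCd w' h).map (fun k l => ((hcC w' hne).1 k l).smul_left _) (fun k l => ((hcC w' hne).2.1 k l).smul_left _)
              ((hcC w' hne).2.2.smul_left _)
        · have hne : w' ≠ w := fun e => hw' (Finset.mem_insert.mpr (Or.inl (by rw [e])))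
          rw [hz'Φ]
          exact (hCt w' fun h => hw' (Finset.mem_insert_of_mem h)).map (fun k l => ((hcC w' hne).1 k l).smul_left _)
            (fun k l => ((hcC w' hne).2.1 k l).smul_left _) ((hcC w' hne).2.2.smul_left _)
        · rw [gardingAct_mul, Module.End.mul_apply, hGe, map_smul, hgz', smul_smul]
  obtain ⟨G, hGR, hGC, c, hc, z, hRd, -, hCd, -, hGe⟩ := key Finset.univ
  have hG : G = weylLong 2 (mixedSpace K) := by
    refine Units.ext (matrix_ext_of_eval K (fun v => ?_) (fun v => ?_))
    · rw [hGR v, if_pos (Finset.mem_univ _), eval_weylLong.1 v]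
    · rw [hGC v, if_pos (Finset.mem_univ _), eval_weylLong.2 v]
  exact ⟨c, hc, z, fun w => hRd w (Finset.mem_univ _), fun w => hCd w (Finset.mem_univ _), by rw [← hG, hGe]⟩

end DualVector

/-! ### 5. The central character at the coordinate units -/

section CentralCharacter

omit [NumberField K] in
/-- `diag(c, c) = diagonal (c)`: the scalar Hecke element. [folklore] -/
theorem glDiagonal_const_eq_diagGL2 (c : (mixedSpace K)ˣ) : glDiagonal 2 (mixedSpace K) (fun _ => c) = diagGL2 c c := by
  rw [diagGL2]; congr 1; funext i; fin_cases i <;> rfl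

omit [NumberField K] in
/-- `E₀₀ ⊗ x + E₁₁ ⊗ x = diagonal(x)`. [folklore] -/
theorem single_zero_zero_add_single_one_one (x : mixedSpace K) :
    Matrix.single (0 : Fin 2) (0 : Fin 2) x + Matrix.single 1 1 x = Matrix.diagonal fun _ => x := by
  refine Matrix.ext fun i j => ?_
  fin_cases i <;> fin_cases j <;> simp [Matrix.single, Matrix.diagonal]

/-- `exp(t • diagonal(x)) = diagonal(exp(t • x))` in `M₂(K_∞)`. [folklore] -/
theorem exp_smul_diagonal_const (t : ℝ) (x : mixedSpace K) :
    NormedSpace.exp (t • (Matrix.diagonal fun _ : Fin 2 => x)) = Matrix.diagonal fun _ : Fin 2 => NormedSpace.exp (t • x) := by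
  open scoped Matrix.Norms.Operator in
  have h : t • (Matrix.diagonal fun _ : Fin 2 => x) = Matrix.diagonal fun _ : Fin 2 => t • x := by
    refine Matrix.ext fun i j => ?_
    by_cases hij : i = j <;> simp [Matrix.diagonal, hij]
  rw [h, Matrix.exp_diagonal]
  congr 1
  funext i
  exact Pi.coe_exp (𝔸 := fun _ : Fin 2 => mixedSpace K) _ i

/-- **`diag(ι_w e^y, ι_w e^y) = exp(y (H₀ + H₁)_w)`** at a real place. [folklore] -/
theorem glDiagonal_realUnitAt_exp (w : {w : InfinitePlace K // IsReal w}) (y : ℝ) :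
    glDiagonal 2 (mixedSpace K) (fun _ => realUnitAt K w (Units.mk0 (Real.exp y) (Real.exp_pos y).ne')) =
      expGL (y • (Matrix.single (0 : Fin 2) (0 : Fin 2) ((Pi.single w 1, 0) : mixedSpace K) + Matrix.single 1 1 ((Pi.single w 1, 0) : mixedSpace K))) := by
  refine Units.ext ?_
  rw [coe_glDiagonal, coe_expGL, single_zero_zero_add_single_one_one, exp_smul_diagonal_const, exp_smul_realIdem]
  congr 1; funext i
  have h := coe_realUnitAt_sub_one (K := K) w (Units.mk0 (Real.exp y) (Real.exp_pos y).ne')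
  rw [sub_eq_iff_eq_add'] at h
  rw [h, Units.val_mk0]

/-- **`diag(ι_w(-1), ι_w(-1)) = exp(π W_w)`** at a real place. [folklore] -/
theorem glDiagonal_realUnitAt_neg_one (w : {w : InfinitePlace K // IsReal w}) :
    glDiagonal 2 (mixedSpace K) (fun _ => realUnitAt K w (-1)) =
      expGL ((Real.pi : ℝ) • (Matrix.single (0 : Fin 2) (1 : Fin 2) ((Pi.single w 1, 0) : mixedSpace K) - Matrix.single 1 0 ((Pi.single w 1, 0) : mixedSpace K))) := by
  open scoped Matrix.Norms.Operator in
  refine Units.ext ?_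
  rw [coe_glDiagonal, coe_expGL, exp_smul_eq_of_sq_eq_neg (weylR_sq (K := K) w).1 (weylR_sq (K := K) w).2, Real.cos_pi, Real.sin_pi, zero_smul,
    add_zero, single_zero_zero_add_single_one_one]
  have h := coe_realUnitAt_sub_one (K := K) w (-1)
  rw [sub_eq_iff_eq_add', Units.val_neg, Units.val_one] at h
  have h1 : ((-1 : ℝ) - 1) • (Matrix.diagonal fun _ : Fin 2 => ((Pi.single w 1, 0) : mixedSpace K)) =
      Matrix.diagonal fun _ : Fin 2 => ((-1 : ℝ) - 1) • ((Pi.single w 1, 0) : mixedSpace K) := by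
    refine Matrix.ext fun i j => ?_
    by_cases hij : i = j <;> simp [Matrix.diagonal, hij]
  rw [h, h1, ← Matrix.diagonal_one, ← Matrix.diagonal_add]

/-- **`diag(ι_w z, ι_w z) = exp((log|z|)(E₀₀+E₁₁) ⊗ c_w) exp((arg z)(E₀₀+E₁₁) ⊗ ic_w)`** at a complex place.
[folklore] -/
theorem glDiagonal_complexUnitAt (w : {w : InfinitePlace K // IsComplex w}) (z : ℂˣ) :
    glDiagonal 2 (mixedSpace K) (fun _ => complexUnitAt K w z) =
      expGL ((Real.log ‖(z : ℂ)‖) • (Matrix.single (0 : Fin 2) (0 : Fin 2) ((0, Pi.single w 1) : mixedSpace K) + Matrix.single 1 1 ((0, Pi.single w 1) : mixedSpace K))) *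
        expGL ((Complex.arg z) • (Matrix.single (0 : Fin 2) (0 : Fin 2) ((0, Pi.single w Complex.I) : mixedSpace K) +
          Matrix.single 1 1 ((0, Pi.single w Complex.I) : mixedSpace K))) := by
  have hz : (z : ℂ) ≠ 0 := z.ne_zero
  refine Units.ext ?_
  rw [Units.val_mul, coe_glDiagonal, coe_expGL, coe_expGL, single_zero_zero_add_single_one_one, single_zero_zero_add_single_one_one,
    exp_smul_diagonal_const, exp_smul_diagonal_const, Matrix.diagonal_mul_diagonal, exp_smul_complexIdem, Real.exp_log (norm_pos_iff.2 hz),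
    exp_smul_complexIdemI]
  congr 1; funext i
  rw [coe_complexUnitAt]
  refine Prod.ext (by simp) (funext fun v => ?_)
  simp only [Prod.snd_mul, Prod.snd_add, Prod.snd_one, Prod.smul_snd, Pi.add_apply, Pi.mul_apply, Pi.one_apply, Pi.smul_apply]
  by_cases hv : v = w
  · subst hv
    simp only [Pi.mulSingle_eq_same, Pi.single_eq_same, Complex.real_smul, mul_one]
    have h := Complex.norm_mul_exp_arg_mul_I (z : ℂ)
    push_cast
    linear_combination -h
  · simp [hv]

variable {hcpt : isCompact_glFiniteIntegralLevel 2 K}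
  {E : Type*} [NormedAddCommGroup E] [InnerProductSpace ℂ E] [CompleteSpace E]
  {τ : ContRepresentation ℂ (AutomorphyDatum.gl 2 K hcpt).arch.carrier E}
  (hτ : τ.IsStronglyContinuous)

/-- `τ(exp(tX)) v = e^{ct} v` on the Gårding space if `τ(X) v = c v`. [cite: Bump1997, §2.2] -/
theorem gardingAct_expGL_smul_of_gardingEnd {X : Matrix (Fin 2) (Fin 2) (mixedSpace K)} {v : archGardingSpace hcpt τ} {c : ℂ}
    (hX : gardingEnd hτ X v = c • v) (t : ℝ) : gardingAct hτ (expGL (t • X)) v = Complex.exp (c * t) • v := by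
  have hE : archDerivE hcpt τ X (v : E) = c • (v : E) := by
    have h1 := congrArg Subtype.val hX
    rwa [coe_gardingEnd_apply, Submodule.coe_smul] at h1
  refine Subtype.ext ?_
  rw [coe_gardingAct_apply, apply_expGL_smul_eq_exp_smul hτ _ v.2 hE, Submodule.coe_smul]

variable {ω : (mixedSpace K)ˣ → ℂ} (hω : ∀ (c : (mixedSpace K)ˣ) (v : E), τ (toArch hcpt (glDiagonal 2 (mixedSpace K) fun _ => c)) v = ω c • v)
include hτ hω

/-- The central character on the Gårding space. [folklore] -/
theorem gardingAct_glDiagonal_const (c : (mixedSpace K)ˣ) (v : archGardingSpace hcpt τ) :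
    gardingAct hτ (glDiagonal 2 (mixedSpace K) fun _ => c) v = ω c • v :=
  Subtype.ext (by rw [coe_gardingAct_apply, hω, Submodule.coe_smul])

variable {e : archGardingSpace hcpt τ} (he : e ≠ 0)
include he

/-- `ω` is multiplicative, `ω(1) = 1`, `ω(a⁻¹) ω(a) = 1` (evaluated on a non-zero vector). [folklore] -/
theorem centralChar_mul : (∀ a b : (mixedSpace K)ˣ, ω (a * b) = ω a * ω b) ∧ ω 1 = 1 ∧ ∀ a : (mixedSpace K)ˣ, ω a⁻¹ * ω a = 1 := by
  have hmul : ∀ a b : (mixedSpace K)ˣ, ω (a * b) = ω a * ω b := by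
    intro a b
    have h1 : (glDiagonal 2 (mixedSpace K) fun _ => a * b) = (glDiagonal 2 (mixedSpace K) fun _ => a) * glDiagonal 2 (mixedSpace K) fun _ => b := by
      rw [← map_mul]; rfl
    have h2 := gardingAct_glDiagonal_const hτ hω (a * b) e
    rw [h1, gardingAct_mul, Module.End.mul_apply, gardingAct_glDiagonal_const hτ hω, gardingAct_glDiagonal_const hτ hω, smul_smul] at h2
    exact (smul_left_injective ℂ he h2).symm
  have hone : ω 1 = 1 := by
    have h2 := gardingAct_glDiagonal_const hτ hω 1 e
    rw [show (glDiagonal 2 (mixedSpace K) fun _ => (1 : (mixedSpace K)ˣ)) = 1 from map_one _, gardingAct_one, Module.End.one_apply] at h2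
    exact smul_left_injective ℂ he (h2.symm.trans (one_smul ℂ e).symm)
  exact ⟨hmul, hone, fun a => by rw [← hmul, inv_mul_cancel, hone]⟩

/-- **`ω(ι_w e^y) = e^{μ_w y}`** if `τ(H₀+H₁)_w = μ_w`. [folklore] -/
theorem centralChar_realUnitAt_exp (w : {w : InfinitePlace K // IsReal w}) {μ : ℂ}
    (hμ : ∀ v : archGardingSpace hcpt τ, gardingEnd hτ (Matrix.single 0 0 ((Pi.single w 1, 0) : mixedSpace K)) v +
      gardingEnd hτ (Matrix.single 1 1 ((Pi.single w 1, 0) : mixedSpace K)) v = μ • v) (y : ℝ) :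
    ω (realUnitAt K w (Units.mk0 (Real.exp y) (Real.exp_pos y).ne')) = Complex.exp (μ * y) := by
  have hX : gardingEnd hτ (Matrix.single (0 : Fin 2) (0 : Fin 2) ((Pi.single w 1, 0) : mixedSpace K) + Matrix.single 1 1 ((Pi.single w 1, 0) : mixedSpace K)) e = μ • e := by
    rw [gardingEnd_add, LinearMap.add_apply, hμ]
  have h := gardingAct_glDiagonal_const hτ hω (realUnitAt K w (Units.mk0 (Real.exp y) (Real.exp_pos y).ne')) e
  rw [glDiagonal_realUnitAt_exp, gardingAct_expGL_smul_of_gardingEnd hτ hX] at h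
  exact (smul_left_injective ℂ he h).symm

/-- **`ω(ι_w(-1)) = e^{ikπ}` if some non-zero vector has weight `k` at `w`.** [folklore] -/
theorem centralChar_realUnitAt_neg_one (w : {w : InfinitePlace K // IsReal w}) {k : ℂ}
    (hW : gardingEnd hτ (Matrix.single (0 : Fin 2) (1 : Fin 2) ((Pi.single w 1, 0) : mixedSpace K) - Matrix.single 1 0 ((Pi.single w 1, 0) : mixedSpace K)) e =
      (Complex.I * k) • e) :
    ω (realUnitAt K w (-1)) = Complex.exp (Complex.I * k * Real.pi) := by
  have h := gardingAct_glDiagonal_const hτ hω (realUnitAt K w (-1)) e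
  rw [glDiagonal_realUnitAt_neg_one, gardingAct_expGL_smul_of_gardingEnd hτ hW] at h
  exact (smul_left_injective ℂ he h).symm

/-- **`ω(ι_w z) = e^{μ₁ log|z| + μ₂ arg z}`** at a complex place with `τ(E₀₀+E₁₁) ⊗ c_w = μ₁`,
`τ(E₀₀+E₁₁) ⊗ ic_w = μ₂`. [folklore] -/
theorem centralChar_complexUnitAt (w : {w : InfinitePlace K // IsComplex w}) {μ₁ μ₂ : ℂ}
    (hZ1 : ∀ v : archGardingSpace hcpt τ, gardingEnd hτ (Matrix.single 0 0 ((0, Pi.single w 1) : mixedSpace K) +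
      Matrix.single 1 1 ((0, Pi.single w 1) : mixedSpace K)) v = μ₁ • v)
    (hZ2 : ∀ v : archGardingSpace hcpt τ, gardingEnd hτ (Matrix.single 0 0 ((0, Pi.single w Complex.I) : mixedSpace K) +
      Matrix.single 1 1 ((0, Pi.single w Complex.I) : mixedSpace K)) v = μ₂ • v) (z : ℂˣ) :
    ω (complexUnitAt K w z) = Complex.exp (μ₁ * Real.log ‖(z : ℂ)‖ + μ₂ * Complex.arg z) := by
  have h := gardingAct_glDiagonal_const hτ hω (complexUnitAt K w z) e
  rw [glDiagonal_complexUnitAt, gardingAct_mul, Module.End.mul_apply, gardingAct_expGL_smul_of_gardingEnd hτ (hZ2 e), map_smul,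
    gardingAct_expGL_smul_of_gardingEnd hτ (hZ1 e), smul_smul, ← Complex.exp_add, add_comm] at h
  exact (smul_left_injective ℂ he h).symm

end CentralCharacter

/-! ### 6. The dual shape functions and the rigidity of the twisted dual Kirillov function -/

/-- The sign condition on `ω(ι_w(-1))` attached to a real tag (`(-1)^k` is irrelevant for the discrete tags,
whose dual Kirillov functions live on `t > 0`). [folklore] -/
def RealTagSign : RealTag → ℂ → Prop
  | .discPlus _, _ => True
  | .weightOneSym _, s => s = -1
  | .weightZero, s => s = 1
  | .weightZeroX, s => s = 1

/-- The untwisted Kirillov shape on `ℝˣ` of the dual real types. [cite: JacquetLanglands1970, §5 Thm. 5.15] -/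
def dualRealShapeRaw (μ ν : ℂ) : RealTag → ℝ → ℂ
  | .discPlus k => realShapeFn 1 0 (expShape ((μ + k) / 2) (2 * Real.pi))
  | .weightOneSym κ => realShapeFn 1 (-1) (besselShape ((μ + 1) / 2) (2 * Real.pi) (Complex.I * (-κ - 1 / 2)))
  | .weightZero => realShapeFn 1 1 (besselShape (μ / 2) (2 * Real.pi) ν)
  | .weightZeroX => realShapeFn 1 1 (besselShape (μ / 2 + 1) (2 * Real.pi) ν)

/-- **The twisted dual shape `ω(ι_w t)⁻¹ · (raw dual shape)` on `ℝˣ`**, again a `realShapeFn`.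
[cite: JacquetLanglands1970, §5 Thm. 5.15, proof of Thm. 11.1] -/
def dualRealShapeOf (μ ν : ℂ) : RealTag → ℝ → ℂ
  | .discPlus k => realShapeFn 1 0 (expShape ((μ + k) / 2 - μ) (2 * Real.pi))
  | .weightOneSym κ => realShapeFn 1 1 (besselShape ((μ + 1) / 2 - μ) (2 * Real.pi) (Complex.I * (-κ - 1 / 2)))
  | .weightZero => realShapeFn 1 1 (besselShape (μ / 2 - μ) (2 * Real.pi) ν)
  | .weightZeroX => realShapeFn 1 1 (besselShape (μ / 2 + 1 - μ) (2 * Real.pi) ν)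

/-- The untwisted Kirillov shape on `ℂˣ` of the dual complex types (with the phase `e^{μ₂ arg z}` of the compact torus).
[cite: JacquetLanglands1970, §6 Thm. 6.4] -/
def dualComplexShapeRaw (μ₁ μ₂ : ℂ) (m : ℕ) (ν ν' : ℂ) : ComplexTag → ℂ → ℂ
  | .holPow b => fun z => Complex.exp (μ₂ * (Complex.arg z : ℂ)) * besselShape ((μ₁ + m + 1) / 2 + b) (4 * Real.pi) ν' ‖z‖
  | .antiPowLowest b => fun z => Complex.exp (μ₂ * (Complex.arg z : ℂ)) * besselShape ((μ₁ + m + 1) / 2 + b) (4 * Real.pi) ν ‖z‖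
  | .string j => fun z => Complex.exp (μ₂ * (Complex.arg z : ℂ)) * besselShape ((μ₁ + m + 1) / 2) (4 * Real.pi) (ν - Complex.I * ((m - j : ℕ) : ℂ)) ‖z‖

/-- **The twisted dual shape on `ℂˣ`**, radial. [cite: JacquetLanglands1970, §6 Thm. 6.4, proof of Thm. 11.1] -/
def dualComplexShapeOf (μ₁ : ℂ) (m : ℕ) (ν ν' : ℂ) : ComplexTag → ℂ → ℂ
  | .holPow b => fun z => besselShape ((μ₁ + m + 1) / 2 + b - μ₁) (4 * Real.pi) ν' ‖z‖
  | .antiPowLowest b => fun z => besselShape ((μ₁ + m + 1) / 2 + b - μ₁) (4 * Real.pi) ν ‖z‖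
  | .string j => fun z => besselShape ((μ₁ + m + 1) / 2 - μ₁) (4 * Real.pi) (ν - Complex.I * ((m - j : ℕ) : ℂ)) ‖z‖

section DualShapes

variable {hcpt : isCompact_glFiniteIntegralLevel 2 K}
  {E : Type*} [NormedAddCommGroup E] [InnerProductSpace ℂ E] [CompleteSpace E]
  {τ : ContRepresentation ℂ (AutomorphyDatum.gl 2 K hcpt).arch.carrier E}
  {hτ : τ.IsStronglyContinuous}
  (hτu : τ.IsUnitary) {ℓ : archGardingSpace hcpt τ →ₗ[ℂ] ℂ} (hℓW : IsArchContWhittakerFunctional hcpt τ hτ ℓ)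
include hτu hℓW

/-- **Kirillov function on `ℝˣ` of a dual-tagged real vector.** [cite: JacquetLanglands1970, §5 Thm. 5.15] -/
theorem DualRealTagged.kirillov {w : {w : InfinitePlace K // IsReal w}} {δ : GL (Fin 2) (mixedSpace K)}
    (hδ : (δ : Matrix (Fin 2) (Fin 2) (mixedSpace K)) = 1 - (2 : ℝ) • Matrix.single (0 : Fin 2) (0 : Fin 2) ((Pi.single w 1, 0) : mixedSpace K))
    {μ lam : ℂ} (ν : ℂ) (hlam : lam = μ ^ 2 / 2 - 2 * ν ^ 2 - 1 / 2) {t : RealTag} {v : archGardingSpace hcpt τ}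
    (h : DualRealTagged hτ w δ μ lam t v) :
    ∃ c : ℂ, ∀ x : ℝˣ, ℓ (gardingAct hτ (diagGL2 (realUnitAt K w x) 1) v) = c * dualRealShapeRaw μ ν t x := by
  cases t with
  | discPlus k =>
    refine h.2.kirillov w hδ hτu hℓW (fun x hx => ?_) (fun x hx => ?_)
    · rw [dualRealShapeRaw, realShapeFn_of_pos _ _ _ hx, one_mul, expShape]
    · rw [dualRealShapeRaw, realShapeFn_of_neg _ _ _ hx, zero_mul]
  | weightOneSym κ =>
    refine RealWeightOneSym.kirillov w hδ hτu hℓW h (fun x hx => ?_) (fun x hx => ?_)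
    · rw [dualRealShapeRaw, realShapeFn_of_pos _ _ _ hx, one_mul, besselShape]
    · rw [dualRealShapeRaw, realShapeFn_of_neg _ _ _ hx, besselShape]
  | weightZero =>
    refine RealWeightZero.kirillov w hδ hτu hℓW h ν hlam (fun x hx => ?_) (fun x hx => ?_)
    · rw [dualRealShapeRaw, realShapeFn_of_pos _ _ _ hx, one_mul, besselShape]
    · rw [dualRealShapeRaw, realShapeFn_of_neg _ _ _ hx, besselShape]
  | weightZeroX =>
    refine RealWeightZeroX.kirillov w hδ hτu hℓW h ν hlam (fun x hx => ?_) (fun x hx => ?_)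
    · rw [dualRealShapeRaw, realShapeFn_of_pos _ _ _ hx, one_mul, besselShape]
    · rw [dualRealShapeRaw, realShapeFn_of_neg _ _ _ hx, besselShape]

/-- **Kirillov function on `ℂˣ` of a dual-tagged complex vector** (the compact torus acts through `e^{μ₂ arg z}` as
`it = μ₂`). [cite: JacquetLanglands1970, §6 Thm. 6.4] -/
theorem DualComplexTagged.kirillov {w : {w : InfinitePlace K // IsComplex w}} {m : ℕ} {μ₁ μ₂ lama lamh ν ν' : ℂ}
    (hlama : lama = (μ₁ + Complex.I * μ₂) ^ 2 / 2 - 2 * ν ^ 2 - 2)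
    (hlamh : lamh = (μ₁ - Complex.I * μ₂) ^ 2 / 2 - 2 * ν' ^ 2 - 2)
    (hZ1 : ∀ v : archGardingSpace hcpt τ, gardingEnd hτ (Matrix.single 0 0 ((0, Pi.single w 1) : mixedSpace K) +
      Matrix.single 1 1 ((0, Pi.single w 1) : mixedSpace K)) v = μ₁ • v)
    (hZ2 : ∀ v : archGardingSpace hcpt τ, gardingEnd hτ (Matrix.single 0 0 ((0, Pi.single w Complex.I) : mixedSpace K) +
      Matrix.single 1 1 ((0, Pi.single w Complex.I) : mixedSpace K)) v = μ₂ • v)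
    (hCa : ∀ v : archGardingSpace hcpt τ, ∑ i : Fin 2, ∑ j : Fin 2,
      (gardingEnd hτ (Matrix.single i j ((0, Pi.single w 1) : mixedSpace K)) + Complex.I • gardingEnd hτ (Matrix.single i j ((0, Pi.single w Complex.I) : mixedSpace K)))
        ((gardingEnd hτ (Matrix.single j i ((0, Pi.single w 1) : mixedSpace K)) + Complex.I • gardingEnd hτ (Matrix.single j i ((0, Pi.single w Complex.I) : mixedSpace K))) v) = lama • v)
    (hCh : ∀ v : archGardingSpace hcpt τ, ∑ i : Fin 2, ∑ j : Fin 2,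
      (gardingEnd hτ (Matrix.single i j ((0, Pi.single w 1) : mixedSpace K)) - Complex.I • gardingEnd hτ (Matrix.single i j ((0, Pi.single w Complex.I) : mixedSpace K)))
        ((gardingEnd hτ (Matrix.single j i ((0, Pi.single w 1) : mixedSpace K)) - Complex.I • gardingEnd hτ (Matrix.single j i ((0, Pi.single w Complex.I) : mixedSpace K))) v) = lamh • v)
    (hrel : ∀ j : ℕ, 0 < j → j < m → lamh = (μ₁ - Complex.I * μ₂) ^ 2 / 2 - 2 * (ν - Complex.I * m) ^ 2 - 2)
    {t : ComplexTag} {v : archGardingSpace hcpt τ} (h : DualComplexTagged hτ w m μ₂ t v) :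
    ∃ c : ℂ, ∀ z : ℂˣ, ℓ (gardingAct hτ (diagGL2 (complexUnitAt K w z) 1) v) = c * dualComplexShapeRaw μ₁ μ₂ m ν ν' t z := by
  cases t with
  | holPow b =>
    obtain ⟨hT, c, hc⟩ := h.1.radial w hτu hℓW μ₁ μ₂ lamh ν' hlamh hZ1 hZ2 hCh
    refine ⟨c, fun z => ?_⟩
    rw [kirillovC_eq_of_radial w hT (hZ2 v) (Φ := fun x : ℝ => (x : ℂ) ^ ((μ₁ + m + 1) / 2 + b) * besselMode (4 * Real.pi) ν' x) hc, h.2,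
      show (μ₂ + μ₂) / 2 = μ₂ by ring]
    simp only [dualComplexShapeRaw, besselShape]; ring
  | antiPowLowest b =>
    obtain ⟨hT, c, hc⟩ := h.1.radial w hτu hℓW μ₁ μ₂ lama ν hlama hZ1 hZ2 hCa
    refine ⟨c, fun z => ?_⟩
    rw [kirillovC_eq_of_radial w hT (hZ2 v) (Φ := fun x : ℝ => (x : ℂ) ^ ((μ₁ + m + 1) / 2 + b) * besselMode (4 * Real.pi) ν x) hc, h.2,
      show (μ₂ + μ₂) / 2 = μ₂ by ring]
    simp only [dualComplexShapeRaw, besselShape]; ring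
  | string j =>
    obtain ⟨hj, hjm, hs, hb⟩ := h
    obtain ⟨hT, c, hc⟩ := hs.radial w hτu hℓW μ₁ μ₂ lama lamh ν hlama (hrel (m - j) (by omega) (by omega)) hZ1 hZ2 hCa hCh
    refine ⟨c, fun z => ?_⟩
    rw [kirillovC_eq_of_radial w hT (hZ2 v) (Φ := fun x : ℝ => (x : ℂ) ^ ((μ₁ + m + 1) / 2) * besselMode (4 * Real.pi) (ν - Complex.I * ((m - j : ℕ) : ℂ)) x) hc,
      hb, show (μ₂ + μ₂) / 2 = μ₂ by ring]
    simp only [dualComplexShapeRaw, besselShape]; ring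

end DualShapes

section TwistedRigidity

variable {hcpt : isCompact_glFiniteIntegralLevel 2 K}
  {E : Type*} [NormedAddCommGroup E] [InnerProductSpace ℂ E] [CompleteSpace E]
  {τ : ContRepresentation ℂ (AutomorphyDatum.gl 2 K hcpt).arch.carrier E}
  (hτ : τ.IsStronglyContinuous)

omit [NumberField K] in
/-- Rigid shapes only see the shape function on units. [folklore] -/
theorem RigidRealAt.congr_units {Ψ : (mixedSpace K)ˣ → ℂ} {w : {w : InfinitePlace K // IsReal w}} {F F' : ℝ → ℂ}
    (h : RigidRealAt Ψ w F) (hF : ∀ t : ℝˣ, F t = F' t) : RigidRealAt Ψ w F' := fun u' hu' => by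
  obtain ⟨c, hc⟩ := h u' hu'; exact ⟨c, fun t => by rw [hc t, hF t]⟩

omit [NumberField K] in
/-- Rigid shapes only see the shape function on units (complex place). [folklore] -/
theorem RigidComplexAt.congr_units {Ψ : (mixedSpace K)ˣ → ℂ} {w : {w : InfinitePlace K // IsComplex w}} {G G' : ℂ → ℂ}
    (h : RigidComplexAt Ψ w G) (hG : ∀ z : ℂˣ, G z = G' z) : RigidComplexAt Ψ w G' := fun u' hu' => by
  obtain ⟨c, hc⟩ := h u' hu'; exact ⟨c, fun z => by rw [hc z, hG z]⟩

variable {ω : (mixedSpace K)ˣ → ℂ} (hω : ∀ (c : (mixedSpace K)ˣ) (v : E), τ (toArch hcpt (glDiagonal 2 (mixedSpace K) fun _ => c)) v = ω c • v)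
  {x₀ : archGardingSpace hcpt τ} (hx₀ : x₀ ≠ 0)

include hτ

/-- The central character as a monoid homomorphism. [folklore] -/
def centralCharHom (hω : ∀ (c : (mixedSpace K)ˣ) (v : E), τ (toArch hcpt (glDiagonal 2 (mixedSpace K) fun _ => c)) v = ω c • v)
    (hx₀ : x₀ ≠ 0) : (mixedSpace K)ˣ →* ℂ where
  toFun := ω
  map_one' := (centralChar_mul hτ hω hx₀).2.1
  map_mul' := (centralChar_mul hτ hω hx₀).1

/-- The real twisting factor `(ω(ι_w t))⁻¹` as a function on `ℝ`. [folklore] -/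
def realTwist (ω : (mixedSpace K)ˣ → ℂ) (w : {w : InfinitePlace K // IsReal w}) (t : ℝ) : ℂ :=
  if h : t = 0 then 0 else (ω (realUnitAt K w (Units.mk0 t h)))⁻¹

/-- The complex twisting factor `(ω(ι_w z))⁻¹` as a function on `ℂ`. [folklore] -/
def complexTwist (ω : (mixedSpace K)ˣ → ℂ) (w : {w : InfinitePlace K // IsComplex w}) (z : ℂ) : ℂ :=
  if h : z = 0 then 0 else (ω (complexUnitAt K w (Units.mk0 z h)))⁻¹

include hω hx₀

/-- **`ω(u⁻¹) = ∏_w (ω(ι_w u_w))⁻¹ ∏_w (ω(ι_w z_w))⁻¹`**: the twist is of product form. [folklore] -/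
theorem centralChar_inv_eq_prod (u : (mixedSpace K)ˣ) :
    ω u⁻¹ = (∏ w, realTwist ω w ((u : mixedSpace K).1 w)) * ∏ w, complexTwist ω w ((u : mixedSpace K).2 w) := by
  obtain ⟨hmul, hone, hinv⟩ := centralChar_mul hτ hω hx₀
  have hu : ω u ≠ 0 := fun h => by have := hinv u; rw [h, mul_zero] at this; exact zero_ne_one this
  have h1 : ω u⁻¹ = (ω u)⁻¹ := eq_inv_of_mul_eq_one_left (hinv u)
  have h2 := char_units_eq_prod (centralCharHom hτ hω hx₀) u
  change ω u = (∏ w, ω (realUnitAt K w (unitsFstAt u w))) * ∏ w, ω (complexUnitAt K w (unitsSndAt u w)) at h2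
  rw [h1, h2, mul_inv, ← Finset.prod_inv_distrib, ← Finset.prod_inv_distrib]
  congr 1
  · refine Finset.prod_congr rfl fun w _ => ?_
    rw [realTwist, dif_neg (units_fst_ne_zero u w)]
  · refine Finset.prod_congr rfl fun w _ => ?_
    rw [complexTwist, dif_neg (units_snd_ne_zero u w)]

/-- **The twisted real shape.** If `ω(ι_w e^y) = e^{μy}` and `ω(ι_w(-1))` has the sign of the tag, then
`(ω(ι_w t))⁻¹ · dualRealShapeRaw = dualRealShapeOf` on `ℝˣ`. [folklore] -/
theorem realTwist_mul_dualRealShapeRaw (w : {w : InfinitePlace K // IsReal w}) {μ : ℂ} (ν : ℂ)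
    (hexp : ∀ y : ℝ, ω (realUnitAt K w (Units.mk0 (Real.exp y) (Real.exp_pos y).ne')) = Complex.exp (μ * y))
    {t : RealTag} (hsgn : RealTagSign t (ω (realUnitAt K w (-1)))) (x : ℝˣ) :
    realTwist ω w x * dualRealShapeRaw μ ν t x = dualRealShapeOf μ ν t x := by
  obtain ⟨hmul, hone, hinv⟩ := centralChar_mul hτ hω hx₀
  have hx : (x : ℝ) ≠ 0 := x.ne_zero
  -- the twist at `|x|`
  have habs : ∀ {r : ℝ} (hr : 0 < r), ω (realUnitAt K w (Units.mk0 r hr.ne')) = (r : ℂ) ^ μ := by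
    intro r hr
    have h1 : Units.mk0 r hr.ne' = Units.mk0 (Real.exp (Real.log r)) (Real.exp_pos _).ne' := Units.ext (by simp [Real.exp_log hr])
    rw [h1, hexp, Complex.cpow_def_of_ne_zero (Complex.ofReal_ne_zero.mpr hr.ne'), ← Complex.ofReal_log hr.le, mul_comm]
  have hshift : ∀ {r : ℝ} (hr : 0 < r) (β : ℂ), ((r : ℂ) ^ μ)⁻¹ * (r : ℂ) ^ β = (r : ℂ) ^ (β - μ) := by
    intro r hr β
    rw [Complex.cpow_sub _ _ (Complex.ofReal_ne_zero.mpr hr.ne'), div_eq_mul_inv, mul_comm]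
  rw [realTwist, dif_neg hx]
  rcases lt_or_gt_of_ne hx with hneg | hpos
  · -- `x < 0`: `ι_w x = ι_w(-1) ι_w |x|`
    have hxabs : 0 < -(x : ℝ) := by linarith
    have hux : Units.mk0 (x : ℝ) hx = -1 * Units.mk0 (-(x : ℝ)) hxabs.ne' := Units.ext (by simp)
    rw [hux, map_mul, hmul, habs hxabs]
    cases t with
    | discPlus k => rw [dualRealShapeRaw, dualRealShapeOf, realShapeFn_of_neg _ _ _ hneg, realShapeFn_of_neg _ _ _ hneg, zero_mul, zero_mul, mul_zero]
    | weightOneSym κ =>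
      rw [RealTagSign] at hsgn
      rw [dualRealShapeRaw, dualRealShapeOf, realShapeFn_of_neg _ _ _ hneg, realShapeFn_of_neg _ _ _ hneg, hsgn, besselShape, besselShape,
        ← hshift hxabs]
      field_simp
    | weightZero =>
      rw [RealTagSign] at hsgn
      rw [dualRealShapeRaw, dualRealShapeOf, realShapeFn_of_neg _ _ _ hneg, realShapeFn_of_neg _ _ _ hneg, hsgn, besselShape, besselShape,
        ← hshift hxabs]
      ring
    | weightZeroX =>
      rw [RealTagSign] at hsgn
      rw [dualRealShapeRaw, dualRealShapeOf, realShapeFn_of_neg _ _ _ hneg, realShapeFn_of_neg _ _ _ hneg, hsgn, besselShape, besselShape,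
        ← hshift hxabs]
      ring
  · -- `x > 0`
    have hux : Units.mk0 (x : ℝ) hx = Units.mk0 (x : ℝ) hpos.ne' := rfl
    rw [hux, habs hpos]
    cases t with
    | discPlus k =>
      rw [dualRealShapeRaw, dualRealShapeOf, realShapeFn_of_pos _ _ _ hpos, realShapeFn_of_pos _ _ _ hpos, expShape, expShape, ← hshift hpos]
      ring
    | weightOneSym κ =>
      rw [dualRealShapeRaw, dualRealShapeOf, realShapeFn_of_pos _ _ _ hpos, realShapeFn_of_pos _ _ _ hpos, besselShape, besselShape, ← hshift hpos]
      ring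
    | weightZero =>
      rw [dualRealShapeRaw, dualRealShapeOf, realShapeFn_of_pos _ _ _ hpos, realShapeFn_of_pos _ _ _ hpos, besselShape, besselShape, ← hshift hpos]
      ring
    | weightZeroX =>
      rw [dualRealShapeRaw, dualRealShapeOf, realShapeFn_of_pos _ _ _ hpos, realShapeFn_of_pos _ _ _ hpos, besselShape, besselShape, ← hshift hpos]
      ring

omit [NumberField K] [CompleteSpace E] hτ hω hx₀ in
/-- **The twisted complex shape**: `(ω(ι_w z))⁻¹ · dualComplexShapeRaw = dualComplexShapeOf` on `ℂˣ` if
`ω(ι_w z) = e^{μ₁ log|z| + μ₂ arg z}`. [folklore] -/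
theorem complexTwist_mul_dualComplexShapeRaw (w : {w : InfinitePlace K // IsComplex w}) {μ₁ μ₂ : ℂ} (m : ℕ) (ν ν' : ℂ)
    (hωz : ∀ z : ℂˣ, ω (complexUnitAt K w z) = Complex.exp (μ₁ * Real.log ‖(z : ℂ)‖ + μ₂ * Complex.arg z))
    (t : ComplexTag) (z : ℂˣ) :
    complexTwist ω w z * dualComplexShapeRaw μ₁ μ₂ m ν ν' t z = dualComplexShapeOf μ₁ m ν ν' t z := by
  have hz : (z : ℂ) ≠ 0 := z.ne_zero
  have hz' : (0 : ℝ) < ‖(z : ℂ)‖ := norm_pos_iff.mpr hz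
  have hshift : ∀ β : ℂ, (Complex.exp (μ₁ * Real.log ‖(z : ℂ)‖ + μ₂ * Complex.arg z))⁻¹ * (Complex.exp (μ₂ * (Complex.arg (z : ℂ) : ℂ)) *
      ((‖(z : ℂ)‖ : ℂ) ^ β)) = (‖(z : ℂ)‖ : ℂ) ^ (β - μ₁) := by
    intro β
    rw [Complex.cpow_sub _ _ (Complex.ofReal_ne_zero.mpr hz'.ne'), Complex.cpow_def_of_ne_zero (Complex.ofReal_ne_zero.mpr hz'.ne') μ₁,
      ← Complex.ofReal_log hz'.le, ← Complex.exp_neg, div_eq_mul_inv, ← Complex.exp_neg, ← mul_assoc, ← Complex.exp_add]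
    rw [mul_comm (((‖(z : ℂ)‖ : ℝ) : ℂ) ^ β)]
    congr 1
    rw [show -(μ₁ * ((Real.log ‖(z : ℂ)‖ : ℝ) : ℂ) + μ₂ * (Complex.arg (z : ℂ) : ℂ)) + μ₂ * (Complex.arg (z : ℂ) : ℂ) =
      -(((Real.log ‖(z : ℂ)‖ : ℝ) : ℂ) * μ₁) by ring]
  have hu : Units.mk0 (z : ℂ) hz = z := Units.ext rfl
  rw [complexTwist, dif_neg hz, hu, hωz]
  cases t with
  | holPow b => simp only [dualComplexShapeRaw, dualComplexShapeOf, besselShape]; rw [← hshift]; ring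
  | antiPowLowest b => simp only [dualComplexShapeRaw, dualComplexShapeOf, besselShape]; rw [← hshift]; ring
  | string j => simp only [dualComplexShapeRaw, dualComplexShapeOf, besselShape]; rw [← hshift]; ring

end TwistedRigidity

/-! ### 7. Rigidity of the (twisted) Kirillov function of `τ(w_L) e` -/

section DualRigidity

variable {hcpt : isCompact_glFiniteIntegralLevel 2 K}
  {E : Type*} [NormedAddCommGroup E] [InnerProductSpace ℂ E] [CompleteSpace E]
  {τ : ContRepresentation ℂ (AutomorphyDatum.gl 2 K hcpt).arch.carrier E}
  (hτ : τ.IsStronglyContinuous)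
  {ω : (mixedSpace K)ˣ → ℂ} (hω : ∀ (c : (mixedSpace K)ˣ) (v : E), τ (toArch hcpt (glDiagonal 2 (mixedSpace K) fun _ => c)) v = ω c • v)

include hω in
/-- **The sign `ω(ι_w(-1))` of a tagged non-zero vector.** [folklore] -/
theorem RealTagged.realTagSign {w : {w : InfinitePlace K // IsReal w}} {δ : GL (Fin 2) (mixedSpace K)} {μ lam : ℂ} {t : RealTag}
    {e : archGardingSpace hcpt τ} (h : RealTagged hτ w δ μ lam t e) (he : e ≠ 0) : RealTagSign t (ω (realUnitAt K w (-1))) := by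
  cases t with
  | discPlus k => trivial
  | weightZero =>
    change ω (realUnitAt K w (-1)) = 1
    rw [centralChar_realUnitAt_neg_one hτ hω he w (k := 0) (by rw [h.weyl, mul_zero, zero_smul]), mul_zero, zero_mul, Complex.exp_zero]
  | weightZeroX =>
    change ω (realUnitAt K w (-1)) = 1
    obtain ⟨v'', hW'', -, -, -, hv⟩ := h.exists_inner
    have hv'' : v'' ≠ 0 := fun h0 => he (by rw [hv, h0, map_zero])
    rw [centralChar_realUnitAt_neg_one hτ hω hv'' w (k := 0) (by rw [hW'', mul_zero, zero_smul]), mul_zero, zero_mul, Complex.exp_zero]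
  | weightOneSym κ =>
    change ω (realUnitAt K w (-1)) = -1
    obtain ⟨v'', hW'', -, -, hv⟩ := h.exists_inner
    have hv'' : v'' ≠ 0 := fun h0 => he (by rw [hv, h0, map_zero, smul_zero, add_zero, map_zero, smul_zero, add_zero])
    rw [centralChar_realUnitAt_neg_one hτ hω hv'' w (k := 1) (by rw [mul_one]; exact hW''), mul_one,
      show Complex.I * (Real.pi : ℂ) = (Real.pi : ℂ) * Complex.I by ring, Complex.exp_pi_mul_I]

variable (hτu : τ.IsUnitary) {ℓ : archGardingSpace hcpt τ →ₗ[ℂ] ℂ} (hℓW : IsArchContWhittakerFunctional hcpt τ hτ ℓ)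
  {μR lamR νR : {w : InfinitePlace K // IsReal w} → ℂ} (hlamR : ∀ w, lamR w = μR w ^ 2 / 2 - 2 * νR w ^ 2 - 1 / 2)
  (hμR : ∀ w (v : archGardingSpace hcpt τ), gardingEnd hτ (Matrix.single 0 0 ((Pi.single w 1, 0) : mixedSpace K)) v +
    gardingEnd hτ (Matrix.single 1 1 ((Pi.single w 1, 0) : mixedSpace K)) v = μR w • v)
  {mx : {w : InfinitePlace K // IsComplex w} → ℕ} {μ₁ μ₂ lama lamh νC νC' sC : {w : InfinitePlace K // IsComplex w} → ℂ}
  (hlama : ∀ w, lama w = (μ₁ w + Complex.I * μ₂ w) ^ 2 / 2 - 2 * νC w ^ 2 - 2)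
  (hlamh : ∀ w, lamh w = (μ₁ w - Complex.I * μ₂ w) ^ 2 / 2 - 2 * νC' w ^ 2 - 2)
  (hZ1 : ∀ w (v : archGardingSpace hcpt τ), gardingEnd hτ (Matrix.single 0 0 ((0, Pi.single w 1) : mixedSpace K) +
    Matrix.single 1 1 ((0, Pi.single w 1) : mixedSpace K)) v = μ₁ w • v)
  (hZ2 : ∀ w (v : archGardingSpace hcpt τ), gardingEnd hτ (Matrix.single 0 0 ((0, Pi.single w Complex.I) : mixedSpace K) +
    Matrix.single 1 1 ((0, Pi.single w Complex.I) : mixedSpace K)) v = μ₂ w • v)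
  (hCa : ∀ w (v : archGardingSpace hcpt τ), ∑ i : Fin 2, ∑ j : Fin 2,
    (gardingEnd hτ (Matrix.single i j ((0, Pi.single w 1) : mixedSpace K)) + Complex.I • gardingEnd hτ (Matrix.single i j ((0, Pi.single w Complex.I) : mixedSpace K)))
      ((gardingEnd hτ (Matrix.single j i ((0, Pi.single w 1) : mixedSpace K)) + Complex.I • gardingEnd hτ (Matrix.single j i ((0, Pi.single w Complex.I) : mixedSpace K))) v) = lama w • v)
  (hCh : ∀ w (v : archGardingSpace hcpt τ), ∑ i : Fin 2, ∑ j : Fin 2,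
    (gardingEnd hτ (Matrix.single i j ((0, Pi.single w 1) : mixedSpace K)) - Complex.I • gardingEnd hτ (Matrix.single i j ((0, Pi.single w Complex.I) : mixedSpace K)))
      ((gardingEnd hτ (Matrix.single j i ((0, Pi.single w 1) : mixedSpace K)) - Complex.I • gardingEnd hτ (Matrix.single j i ((0, Pi.single w Complex.I) : mixedSpace K))) v) = lamh w • v)
  (hrel : ∀ w (j : ℕ), 0 < j → j < mx w → lamh w = (μ₁ w - Complex.I * μ₂ w) ^ 2 / 2 - 2 * (νC w - Complex.I * mx w) ^ 2 - 2)
  (hsC : ∀ w (v : archGardingSpace hcpt τ), gardingAct hτ (diagGL2 (complexUnitAt K w (-1)) (complexUnitAt K w (-1))) v = sC w • v)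
  (hsC0 : ∀ w, sC w ≠ 0)
  (tagR : {w : InfinitePlace K // IsReal w} → RealTag) (tagC : {w : InfinitePlace K // IsComplex w} → ComplexTag)
  {e : archGardingSpace hcpt τ} (he : e ≠ 0) (hR : ∀ w, RealTagged hτ w (realPlaceGL K w reflGLR) (μR w) (lamR w) (tagR w) e)
  (hC : ∀ w, ComplexTagged hτ w (mx w) (μ₂ w) (tagC w) e)

include hω hτu hℓW hlamR hμR hlama hlamh hZ1 hZ2 hCa hCh hrel hsC hsC0 he hR hC

/-- **Rigidity of the twisted dual Kirillov function `u ↦ ω(u⁻¹) W_{τ(w_L)e}(diag(u,1))` at every place**, with the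
explicit twisted dual shapes. [cite: JacquetLanglands1970, §5 Thm. 5.15, §6 Thm. 6.4, proof of Thm. 11.1 (p. 173)] -/
theorem rigid_twisted_dual_kirillovFn :
    (∀ w, RigidRealAt (fun u : (mixedSpace K)ˣ => ω u⁻¹ * kirillovFn hτ ℓ (gardingAct hτ (weylLong 2 (mixedSpace K)) e) u) w
      (dualRealShapeOf (μR w) (νR w) (tagR w))) ∧
    ∀ w, RigidComplexAt (fun u : (mixedSpace K)ˣ => ω u⁻¹ * kirillovFn hτ ℓ (gardingAct hτ (weylLong 2 (mixedSpace K)) e) u) w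
      (dualComplexShapeOf (μ₁ w) (mx w) (νC w) (νC' w) (tagC w)) := by
  have hδ : ∀ w : {w : InfinitePlace K // IsReal w}, ((realPlaceGL K w reflGLR : GL (Fin 2) (mixedSpace K)) : Matrix (Fin 2) (Fin 2) (mixedSpace K)) =
      1 - (2 : ℝ) • Matrix.single (0 : Fin 2) (0 : Fin 2) ((Pi.single w 1, 0) : mixedSpace K) := fun w => coe_realPlaceGL_reflGLR (K := K) w
  obtain ⟨c, hc, z, hzR, hzC, hwe⟩ := exists_dual_vector hτ hτu hℓW hlamR hlama hlamh hZ1 hZ2 hCa hCh hrel hsC hsC0 tagR tagC hR hC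
  -- the untwisted function is rigid with the raw dual shapes
  have hrawR : ∀ w, RigidRealAt (kirillovFn hτ ℓ (gardingAct hτ (weylLong 2 (mixedSpace K)) e)) w (dualRealShapeRaw (μR w) (νR w) (tagR w)) := by
    intro w
    refine rigidRealAt_kirillovFn hτ ℓ fun u' hu' => ?_
    obtain ⟨c', hc'⟩ := DualRealTagged.kirillov hτu hℓW (hδ w) (νR w) (hlamR w)
      ((hzR w).map (fun i j => commute_gardingAct_diagGL2_letters w hu' i j) (commute_gardingAct_diagGL2_realSign w (hδ w) u'))
    exact ⟨c * c', fun t => by rw [hwe, map_smul, map_smul, map_smul, smul_eq_mul, hc' t, mul_assoc]⟩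
  have hrawC : ∀ w, RigidComplexAt (kirillovFn hτ ℓ (gardingAct hτ (weylLong 2 (mixedSpace K)) e)) w
      (dualComplexShapeRaw (μ₁ w) (μ₂ w) (mx w) (νC w) (νC' w) (tagC w)) := by
    intro w
    refine rigidComplexAt_kirillovFn hτ ℓ fun u' hu' => ?_
    obtain ⟨c', hc'⟩ := DualComplexTagged.kirillov hτu hℓW (hlama w) (hlamh w) (hZ1 w) (hZ2 w) (hCa w) (hCh w) (hrel w)
      ((hzC w).map (fun i j => commute_gardingAct_diagGL2_lettersC w hu' 1 i j) (fun i j => commute_gardingAct_diagGL2_lettersC w hu' Complex.I i j)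
        (commute_gardingAct_diagGL2_weylRotC w hu'))
    exact ⟨c * c', fun t => by rw [hwe, map_smul, map_smul, map_smul, smul_eq_mul, hc' t, mul_assoc]⟩
  -- the twist is of product form
  have htw : (fun u : (mixedSpace K)ˣ => ω u⁻¹ * kirillovFn hτ ℓ (gardingAct hτ (weylLong 2 (mixedSpace K)) e) u) = fun u : (mixedSpace K)ˣ =>
      ((∏ v, realTwist ω v ((u : mixedSpace K).1 v)) * ∏ v, complexTwist ω v ((u : mixedSpace K).2 v)) *
        kirillovFn hτ ℓ (gardingAct hτ (weylLong 2 (mixedSpace K)) e) u := by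
    funext u; rw [centralChar_inv_eq_prod hτ hω he u]
  rw [htw]
  refine ⟨fun w => ?_, fun w => ?_⟩
  · exact ((hrawR w).mul_prod (realTwist ω) (complexTwist ω)).congr_units fun t =>
      realTwist_mul_dualRealShapeRaw hτ hω he w (νR w) (centralChar_realUnitAt_exp hτ hω he w (hμR w)) ((hR w).realTagSign hτ hω he) t
  · exact ((hrawC w).mul_prod (realTwist ω) (complexTwist ω)).congr_units fun z =>
      complexTwist_mul_dualComplexShapeRaw w (mx w) (νC w) (νC' w) (centralChar_complexUnitAt hτ hω he w (hZ1 w) (hZ2 w)) (tagC w) z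

end DualRigidity

end Literature.NumberTheory.Automorphic
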